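import Literature.NumberTheory.LFunctions.SonineMellinFunctionalEquation
import Literature.Analysis.Complex.CauchyTaylorBall
import HarnessLib

/-!
# Burnol 2004b, Prop. 2.2 (= de Branges–Burnol, Forum Math. Thm. 6.10): the Mellin transform on the
# extended Sonine spaces `L_a` — continuation, trivial zeros, bounded evaluations, functional equation

LINE 1 — LABEL: RH-FREE (Fourier/Mellin analysis of even `L²` functions that are CONSTANT on `(−a,a)`
together with their cosine transform; the Riemann zeta function does not occur). FRAMING (cell rh-crit,
D-0074): corpus theorems are RH-FREE literature; nothing here is worded as progress toward RH. bears_on: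
B-C/B-P (LADDER-RH COLUMN 6, de Branges framework): this is the existence-and-continuity statement behind
Burnol's `L̂_a`, the evaluators `Y^a_{w,k}` and everything in [Burnol2004b, §§4–6] that says "`G ∈ L̂_a`".
WHAT THIS IS NOT: not a route, not a criterion; discharging an as-printed structural proposition fixes
corpus vocabulary and moves RH by nothing. Nothing here bears on the truth of RH.

Sources. J.-F. Burnol, *Two complete and minimal systems associated with the zeros of the Riemann zeta
function*, JTNB **16** (2004) 65–94 = arXiv:math/0203120v7 [Burnol2004b], Prop. 2.2 (TeX of record
`rh-crit/dbl/src/Burnol2004JTNB_arXivmath0203120v7.tex` l.460–476) = J.-F. Burnol, *On Fourier and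
Zeta(s)*, Forum Math. **16** (2004) [Burnol2004], Thm. 6.10 with its PROOF (TeX of record
`Burnol2004ForumMath_arXivmath0112254.tex` l.2417–2468); J.-F. Burnol, CRAS **333** (2001)
[Burnol2001CRAS], §1 eq. (1.2)–(1.3), Lemmes 1.2–1.3 (the kernels `C_a(u,w)`, `D_a(u,w)`).

## What is PROVED (theorem-only module: no definition, no new named fact; net debt −1)

* `Burnol2004b_prop2_2_holds : Burnol2004b_prop2_2` — the DISCHARGE of the named fact of
  `BurnolZetaSystems.lean`, all five typed clauses, for every `a > 0`:
  (i) `exists_hasRightMellinContinuation_of_mem_sonineL` (also `Burnol2004b_prop2_2_i`,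
  `hasRightMellinContinuation_rightMellinExt_of_mem_sonineL`, `rightMellinExt_pole_and_zeros_of_mem_sonineL`):
  for `f ∈ L_a`, `f̂` continues holomorphically to `ℂ ∖ {1}`, `(s−1)G(s)` converges at `1`, `G(−2(n+1)) = 0`;
  (ii) `SonineLContinuation.exists_bound_burnolEval_of_sonineL`: for `w ≠ 1`, `w ∉ {0,−2,−4,…}`, `k ∈ ℕ`
  the evaluation `f ↦ M(f)^{(k)}(w)` (`burnolEval`) is bounded by `C(a,w,k)‖f‖` on `L_a`;
  (iii) `SonineLContinuation.exists_bound_residueAt_rightMellinExt_one_of_sonineL`: `|Res_1 f̂| ≤ ‖f‖/√(2a)`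
  (the residue is `−c`, `c` the constant value of `f` on `(−a,a)`);
  (iv) `SonineLContinuation.exists_bound_rightMellinExt_zero_of_sonineL`: `|f̂(0)| ≤ C(a)‖f‖`;
  (v) `SonineLContinuation.rightMellinExt_functionalEquation_of_mem_sonineL`:
  `Γ_ℝ(s)·(𝓕f)^(s) = Γ_ℝ(1−s)·f̂(1−s)` for `s ∉ −2ℕ`, `s ∉ 1+2ℕ` (canonical continuations `rightMellinExt`).
* The explicit continuation behind all of it (section G, `SonineLContinuation.explicit_*`,
  `rightMellinExt_eqOn_explicit`): `G_f(s) = c·a^{1−s}/(1−s) + c'·(J(2πa,a,−1−s) − J(−2πa,a,−1−s))/(2πi)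
  + ∫_a^∞ 𝓕f(u)C_a(u,1−s)du`, with `(s−1)G_f(s) → −c`.

## The printed proof (Forum Math. Thm. 6.10, TeX l.2430–2462) and how it is followed

"The square integrable function `f(t)` is a constant `α(f)` for `0 < t < λ` … In this strip we may write
`∫_0^∞ f(t)t^{−s}dt = α(f)λ^{1−s}/(1−s) + ∫_λ^∞ f(t)t^{−s}dt` … We have
`∫_λ^∞ f(t)t^{−s}dt = ∫_0^∞ 𝓕₊(f)(u)𝓕₊(𝟙_{t>λ}t^{−s})(u)du`. We known from [cras2, Lemme 1.3] that the
function `𝓕₊(𝟙_{t>λ}t^{−s})(u)` is an entire function of `s`, which is `O(1/u)` on `(λ,∞)`, and also that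
it is `χ₊(s)u^{s−1} + O(1)` on `(0,λ)`. Moreover `𝓕₊(f)(u)` is a constant in the interval `(0,λ)`.
Combining these informations we get … an analytic continuation … The continuous linear forms
`f ↦ lim (s−1)f̂(s)`, `f ↦ f̂(w)` (`w ≠ 1`) … The functional equation follows from the fact that it holds
on the critical line". In the left Mellin variable `w = 1 − s` (so that `f̂(s) = ∫_0^∞ f(t)t^{w−1}dt`, the
tree's `rightMellin f s = mellin f (1 − s)`), with `c`, `c'` the constants of `f`, `𝓕₊f` on `(0,a)` and
`C_a(u,w)`, `J(λ,a,z)` the ENTIRE kernels `SonineMellin.cosKernel`, `SonineMellin.ibpEntire` of dbl-t14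
g2's `BurnolCosineKernelEntire.lean`:

* §B `mellin_eq_const_add_mellin_trunc`: `∫_0^∞ f t^{w−1} = c·a^w/w + ∫_0^∞ g t^{w−1}`, `g = 𝟙_{|t|>a}f`,
  on `0 < Re w < 1/2`;
* §C `half_integral_mul_gw_eq` (`Re w < 0`): `∫_0^∞ g t^{w−1} = ½∫_ℝ f·g_w = ½∫ 𝓕f·𝓕g_w`
  (multiplication formula; `g_w = |x|^{w−1}𝟙_{|x|>a}`, `𝓕g_w = C_a(·,w)` = g2's `fourierIntegral_gw`)
  `= c'·∫_0^a C_a(u,w)du + ∫_a^∞ 𝓕f(u)C_a(u,w)du`;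
* §D `setIntegral_Ioc_cosKernel`: the contribution of the constant `c'` —
  `∫_0^a C_a(u,w)du = (J(2πa,a,w−2) − J(−2πa,a,w−2))/(2πi)` (`= (1/π)∫_a^∞ sin(2πat)t^{w−2}dt`), an
  ENTIRE function of `w` (multiplication formula against `𝟙_{(−a,a)}`, whose transform is
  `sin(2πat)/(πt)`);
* §E `mellin_trunc_eq`: identity theorem from `Re w < 0` to `Re w < 1/2` (`differentiableOn_mellin`);
* §F the trivial zeros: at `w = 1 + 2j` (`s = −2j`, `j ≥ 1`) the three pieces cancel —
  `∫_a^∞ 𝓕f·C_a(·,1+2j) = −c·a^{2j+1}/(2j+1) + c'∫_0^a 𝓕(x^{2j}𝟙_{|x|<a})` (`C_a(u,1+2j) = −𝓕(x^{2j}𝟙)(u)`,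
  g2's `cosKernel_one_add_two_mul`), the sine moment at the ODD exponent `2j−1` terminates
  (`ibpEntire_sub_ibpEntire_neg_odd`, twin of g2's even lemma) and equals `−∫_0^a 𝓕(x^{2j}𝟙_{|x|<a})`
  (`setIntegral_Ioc_fourier_hj`). At `w = 1` (`s = 0`) there is NO zero in general ("possibly does not
  vanish at `s = 0`", [Burnol2004b, §4 Note]): there the sine moment does not terminate.
* §G–§I: the explicit `G_f`, `(s−1)G_f(s) → −c`, `Res_1 = −c` (`residueAt_eq_of_principalPart`), and the
  norm bookkeeping `|c|√(2a) ≤ ‖f‖`, `|c'|√(2a) ≤ ‖𝓕f‖ = ‖f‖` (Plancherel, `Lp.norm_fourier_eq`) with g2's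
  `L²` tail bound `exists_bound_sonineMellinExt` ⇒ clauses (iii), (iv).
* §J–§N the functional equation ("it holds on the critical line" is replaced by a direct computation on
  the strip `1/2 < Re s < 1`, then the identity theorem): with the test function `h_w = |x|^{w−1}𝟙_{|x|<a}`
  (`1/2 < Re w < 1`) and the tree's closed forms for the `L¹` kernels of [Burnol2001CRAS] eq. (1.3)
  (`hasMellin_sincKernel`, g2's `cosKernel_eq_closedForm`: `C_a(u,w) = χ₊(w)u^{−w}·𝟙_{u>a}-part − D_a(u,w)`):
  §K the sine moment in closed form `E(w) + ∫_0^a D = χ₊(w)a^{1−w}/(1−w)`, §L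
  `∫_a^∞ 𝓕f·D_a(·,w) = c·a^w/w − c'∫_0^a D_a`, §M `∫_a^∞ 𝓕f·C_a(·,w) = χ₊(w)∫_a^∞ 𝓕f·u^{−w} − ∫_a^∞ 𝓕f·D_a`,
  §N `Γ_ℝ(1−s)χ₊(s) = Γ_ℝ(s)` and the strip identity `Γ_ℝ(s)G_{𝓕f}(s) = Γ_ℝ(1−s)G_f(1−s)`
  (`fe_on_strip`), extended to `{Γ_ℝ(s) ≠ 0} ∩ {Γ_ℝ(1−s) ≠ 0} = ℂ ∖ (−2ℕ ∪ (1+2ℕ))` (open, complement of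
  a countable set hence connected; `fe_off_poles`) ⇒ clause (v) (§O).
* §P clause (ii): near an admissible `w` the completed transform is `Γ_ℝ·G_f`, bounded on a fixed disc by
  `K(a,w)‖f‖` (the bookkeeping of §H–§I); Cauchy's inequality
  (`Literature.Analysis.Complex.norm_iteratedDeriv_le_of_forall_mem_ball`) bounds `M(f)^{(k)}(w)`.

DEVIATION FROM PRINT (declared): Burnol continues to `Re s < 1` through the functional equation "as it
holds on the critical line" (Mellin–Plancherel, [Burnol2004b] eq. (1.1)); here, as in g2's treatment of
`K_a` (`SonineMellinEntire.lean`), the right-hand side of the multiplication formula is ALREADY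
holomorphic off `s = 1`, so clause (i) needs no functional equation, and the functional equation itself is
proved on the open strip `1/2 < Re s < 1` by the explicit kernels (no `L²` boundary values are used).
"Continuous linear forms" is typed (as in the named fact) as a norm bound `≤ C‖f‖` on the set `L_a`.

## References
* [Burnol2004b] J.-F. Burnol, JTNB 16 (2004) = arXiv:math/0203120v7, Prop. 2.2 (p. 5, TeX l.460–476),
  §4 Note (TeX l.614–623).
* [Burnol2004] J.-F. Burnol, Forum Math. 16 (2004) = arXiv:math/0112254, Thm. 6.10 and proof
  (TeX l.2417–2468).
* [Burnol2001CRAS] J.-F. Burnol, CRAS 333 (2001) = arXiv:math/0105120, eq. (1.2)–(1.3), Lemmes 1.2–1.3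
  (TeX l.320–367).
-/

noncomputable section

open MeasureTheory Complex Filter Set FourierTransform
open scoped Topology Real ENNReal

namespace Literature.NumberTheory.LFunctions

namespace SonineLContinuation

open Literature.Analysis.DeBrangesSpaces.SonineMellin
open Literature.Analysis.DeBrangesSpaces.Burnol2001 (gammaPlus)

/-! ### A. Plumbing (private copies of the plumbing of `SonineMellinEntire.lean`) -/

/-- Pull-back of an a.e. property along `x ↦ −x`. [folklore] -/
private theorem ae_comp_neg {p : ℝ → Prop} (h : ∀ᵐ y : ℝ, p y) : ∀ᵐ x : ℝ, p (-x) :=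
  (Measure.measurePreserving_neg (volume : Measure ℝ)).quasiMeasurePreserving.ae h

/-- Almost every real number is non-zero. [folklore] -/
private theorem ae_ne_zero : ∀ᵐ x : ℝ, x ≠ 0 := by
  have : (volume : Measure ℝ) {0} = 0 := measure_singleton 0
  filter_upwards [measure_eq_zero_iff_ae_notMem.1 this] with u hu
  simpa using hu

/-- An a.e.-even function which is a.e. the constant `c` on `(0,a)` is a.e. `c` on `(−a, a)`. [folklore] -/
private theorem ae_const_Ioo_of_even {g : ℝ → ℂ} {a : ℝ} {c : ℂ} (heven : ∀ᵐ x : ℝ, g (-x) = g x)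
    (hc : ∀ᵐ x : ℝ, x ∈ Ioo 0 a → g x = c) : ∀ᵐ x : ℝ, x ∈ Ioo (-a) a → g x = c := by
  filter_upwards [heven, hc, ae_comp_neg (p := fun x ↦ x ∈ Ioo 0 a → g x = c) hc, ae_ne_zero]
    with x he h1 h2 hx0 hxI
  rcases lt_or_gt_of_ne hx0 with hneg | hpos
  · rw [← he]; exact h2 ⟨by linarith, by linarith [hxI.1]⟩
  · exact h1 ⟨hpos, hxI.2⟩

/-- `∫_ℝ h = ∫_{(0,∞)} (h(x) + h(−x)) dx` for integrable `h`. [folklore] -/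
private theorem integral_eq_integral_Ioi_add_neg {h : ℝ → ℂ} (hh : Integrable h) :
    ∫ x, h x = ∫ x in Ioi 0, (h x + h (-x)) := by
  have h1 : IntegrableOn h (Iic 0) := hh.integrableOn
  have h2 : IntegrableOn h (Ioi 0) := hh.integrableOn
  have h3 : IntegrableOn (fun x ↦ h (-x)) (Ioi 0) := hh.comp_neg.integrableOn
  rw [← intervalIntegral.integral_Iic_add_Ioi h1 h2, integral_add h2 h3, add_comm]
  congr 1
  rw [integral_comp_neg_Ioi]; simp

/-- For an integrable a.e.-even `h`: `∫_ℝ h = 2∫_0^∞ h`. [folklore] -/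
private theorem integral_eq_two_mul_integral_Ioi_zero {h : ℝ → ℂ} (hh : Integrable h)
    (heven : ∀ᵐ x : ℝ, h (-x) = h x) :
    ∫ x, h x = 2 * ∫ x in Ioi 0, h x := by
  rw [integral_eq_integral_Ioi_add_neg hh]
  have e1 : ∫ x in Ioi 0, (h x + h (-x)) = ∫ x in Ioi 0, 2 * h x := by
    refine integral_congr_ae ?_
    filter_upwards [ae_restrict_of_ae (s := Ioi 0) heven] with x hx
    rw [hx]; ring
  rw [e1, integral_const_mul]

/-- An even function integrable on `(0,∞)` is integrable on `ℝ`. [folklore] -/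
private theorem integrable_of_even {E : Type*} [NormedAddCommGroup E] {h : ℝ → E}
    (heven : ∀ x, h (-x) = h x) (hh : IntegrableOn h (Ioi 0)) : Integrable h := by
  have h1 : IntegrableOn h (Ici 0) := (integrableOn_Ici_iff_integrableOn_Ioi).mpr hh
  have h2 : IntegrableOn h (Iic 0) := by
    have hmp := Measure.measurePreserving_neg (volume : Measure ℝ)
    have hme : MeasurableEmbedding (fun x : ℝ ↦ -x) := (Homeomorph.neg ℝ).measurableEmbedding
    have := (hmp.integrableOn_comp_preimage hme (f := h) (s := Ici 0)).mpr h1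
    have hpre : (fun x : ℝ ↦ -x) ⁻¹' (Ici 0) = Iic 0 := by ext x; simp
    rw [hpre] at this
    refine this.congr_fun (fun x _ ↦ ?_) measurableSet_Iic
    simp [heven]
  have := h2.union hh
  rwa [Iic_union_Ioi, integrableOn_univ] at this

/-! The kernel `g_w = |x|^{w−1}𝟙_{|x|>a}` (`Re w < 0`: `L¹`; `Re w < 1/2`: `L²`). -/

/-- `g_w` is even. [folklore] -/
private theorem gw_neg (a : ℝ) (w : ℂ) (x : ℝ) :
    (Set.indicator {x : ℝ | a < |x|} (fun x : ℝ ↦ ((|x| : ℝ) : ℂ) ^ (w - 1))) (-x) =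
      (Set.indicator {x : ℝ | a < |x|} (fun x : ℝ ↦ ((|x| : ℝ) : ℂ) ^ (w - 1))) x := by
  simp [Set.indicator, abs_neg]

/-- On `x > 0`, `g_w(x) = 𝟙_{(a,∞)}(x)·x^{w−1}`. [folklore] -/
private theorem gw_eq_indicator_of_pos (a : ℝ) (w : ℂ) {x : ℝ} (hx : 0 < x) :
    (Set.indicator {x : ℝ | a < |x|} (fun x : ℝ ↦ ((|x| : ℝ) : ℂ) ^ (w - 1))) x =
      Set.indicator (Ioi a) (fun x : ℝ ↦ (x : ℂ) ^ (w - 1)) x := by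
  simp [Set.indicator, abs_of_pos hx]

/-- `g_w` is measurable. [folklore] -/
private theorem measurable_gw (a : ℝ) (w : ℂ) :
    Measurable (Set.indicator {x : ℝ | a < |x|} (fun x : ℝ ↦ ((|x| : ℝ) : ℂ) ^ (w - 1))) := by
  refine Measurable.indicator ?_ (isOpen_lt continuous_const continuous_abs).measurableSet
  exact (Complex.measurable_ofReal.comp continuous_abs.measurable).pow_const _

/-- `g_w ∈ L¹((0,∞))` for `Re w < 0`. [folklore] -/
private theorem integrableOn_gw_Ioi {a : ℝ} (ha : 0 < a) {w : ℂ} (hw : w.re < 0) :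
    IntegrableOn (Set.indicator {x : ℝ | a < |x|} (fun x : ℝ ↦ ((|x| : ℝ) : ℂ) ^ (w - 1))) (Ioi 0) := by
  have h1 : IntegrableOn (fun x : ℝ ↦ (x : ℂ) ^ (w - 1)) (Ioi a) :=
    integrableOn_Ioi_cpow_of_lt (by simp; linarith) ha
  have h2 : IntegrableOn (Set.indicator (Ioi a) (fun x : ℝ ↦ (x : ℂ) ^ (w - 1))) (Ioi 0) :=
    (h1.integrable_indicator measurableSet_Ioi).integrableOn
  exact h2.congr_fun (fun x hx ↦ (gw_eq_indicator_of_pos a w hx).symm) measurableSet_Ioi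

/-- `g_w ∈ L¹(ℝ)` for `Re w < 0`. [folklore] -/
private theorem integrable_gw {a : ℝ} (ha : 0 < a) {w : ℂ} (hw : w.re < 0) :
    Integrable (Set.indicator {x : ℝ | a < |x|} (fun x : ℝ ↦ ((|x| : ℝ) : ℂ) ^ (w - 1))) :=
  integrable_of_even (gw_neg a w) (integrableOn_gw_Ioi ha hw)

/-- `g_w ∈ L²(ℝ)` for `Re w < 1/2`. [folklore] -/
private theorem memLp_gw {a : ℝ} (ha : 0 < a) {w : ℂ} (hw : w.re < 1 / 2) :
    MemLp (Set.indicator {x : ℝ | a < |x|} (fun x : ℝ ↦ ((|x| : ℝ) : ℂ) ^ (w - 1))) 2 volume := by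
  rw [memLp_two_iff_integrable_sq_norm (measurable_gw a w).aestronglyMeasurable]
  have h1 : IntegrableOn (fun x : ℝ ↦ x ^ (2 * (w.re - 1))) (Ioi a) :=
    integrableOn_Ioi_rpow_of_lt (by linarith) ha
  have h2 : IntegrableOn (fun x ↦ ‖(Set.indicator {x : ℝ | a < |x|}
      (fun x : ℝ ↦ ((|x| : ℝ) : ℂ) ^ (w - 1))) x‖ ^ 2) (Ioi 0) := by
    have h3 : IntegrableOn (Set.indicator (Ioi a) (fun x : ℝ ↦ x ^ (2 * (w.re - 1)))) (Ioi 0) :=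
      (h1.integrable_indicator measurableSet_Ioi).integrableOn
    refine h3.congr_fun (fun x hx ↦ ?_) measurableSet_Ioi
    rw [gw_eq_indicator_of_pos a w hx]
    by_cases hxa : a < x
    · rw [Set.indicator_of_mem (show x ∈ Ioi a from hxa), Set.indicator_of_mem (show x ∈ Ioi a from hxa),
        norm_cpow_eq_rpow_re_of_pos hx, ← Real.rpow_natCast, ← Real.rpow_mul hx.le]
      congr 1; simp; ring
    · rw [Set.indicator_of_notMem (show x ∉ Ioi a from hxa),
        Set.indicator_of_notMem (show x ∉ Ioi a from hxa)]
      simp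
  have hev : ∀ x : ℝ, (fun x ↦ ‖(Set.indicator {x : ℝ | a < |x|}
      (fun x : ℝ ↦ ((|x| : ℝ) : ℂ) ^ (w - 1))) x‖ ^ 2) (-x) =
      (fun x ↦ ‖(Set.indicator {x : ℝ | a < |x|}
      (fun x : ℝ ↦ ((|x| : ℝ) : ℂ) ^ (w - 1))) x‖ ^ 2) x := by
    intro x; simp [gw_neg]
  exact integrable_of_even hev h2


/-- Almost every real number differs from a given one. [folklore] -/
private theorem ae_ne (a : ℝ) : ∀ᵐ x : ℝ, x ≠ a := by
  have : (volume : Measure ℝ) {a} = 0 := measure_singleton a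
  filter_upwards [measure_eq_zero_iff_ae_notMem.1 this] with u hu
  simpa using hu

/-! ### B. The truncation `g = 𝟙_{|x|>a}·f` and the strip decomposition `f̂(w) = c·a^w/w + ĝ(w)` -/

section Trunc

variable {a : ℝ} (ha : 0 < a) (f g : Lp ℂ 2 (volume : Measure ℝ))
  (hg : ∀ᵐ x : ℝ, g x = Set.indicator {x : ℝ | a < |x|} (f : ℝ → ℂ) x)

include hg in
/-- The truncation vanishes a.e. on `[−a, a]`. [folklore] -/
private theorem trunc_ae_zero : ∀ᵐ x : ℝ, x ∈ Icc (-a) a → g x = 0 := by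
  filter_upwards [hg] with x hx hxI
  rw [hx, Set.indicator_of_notMem]
  simp only [mem_setOf_eq, not_lt]
  exact abs_le.2 ⟨hxI.1, hxI.2⟩

include hg in
/-- The truncation of an even class is even. [folklore] -/
private theorem trunc_even (heven : ∀ᵐ x : ℝ, f (-x) = f x) : ∀ᵐ x : ℝ, g (-x) = g x := by
  filter_upwards [hg, ae_comp_neg (p := fun x ↦ g x = Set.indicator {x : ℝ | a < |x|} (f : ℝ → ℂ) x)
    hg, heven] with x h1 h2 h3
  rw [h2, h1]
  simp only [Set.indicator, mem_setOf_eq, abs_neg]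
  split_ifs <;> simp [h3]

include ha hg in
/-- `t^{w−1}g(t)` is integrable on `(0,∞)` for `Re w < 1/2` (Cauchy–Schwarz against `g_w ∈ L²`).
[cite: Burnol2001CRAS, §1 (TeX l.288–290)] -/
private theorem integrableOn_cpow_smul_trunc {w : ℂ} (hw : w.re < 1 / 2) :
    IntegrableOn (fun t : ℝ ↦ (t : ℂ) ^ (w - 1) • g t) (Ioi 0) := by
  have h1 : Integrable (fun x ↦ g x *
      Set.indicator {x : ℝ | a < |x|} (fun x : ℝ ↦ ((|x| : ℝ) : ℂ) ^ (w - 1)) x) :=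
    (Lp.memLp g).integrable_mul (memLp_gw ha hw)
  refine (h1.integrableOn (s := Ioi 0)).congr_fun_ae ?_
  filter_upwards [ae_restrict_mem measurableSet_Ioi, ae_restrict_of_ae (s := Ioi 0) hg] with x hx hgx
  have hx' : (0 : ℝ) < x := hx
  rw [gw_eq_indicator_of_pos a w hx', smul_eq_mul]
  by_cases hxa : a < x
  · rw [Set.indicator_of_mem (show x ∈ Ioi a from hxa)]; ring
  · rw [Set.indicator_of_notMem (show x ∉ Ioi a from hxa), hgx, Set.indicator_of_notMem]
    · simp
    · simpa [abs_of_pos hx'] using hxa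

include ha hg in
/-- **Strip decomposition**: for `0 < Re w < 1/2` and `f = c` a.e. on `(−a,a)`,
`∫_0^∞ f(t)t^{w−1}dt = c·a^w/w + ∫_0^∞ g(t)t^{w−1}dt` ("`∫_0^∞ f(t)t^{−s}dt = α(f)λ^{1−s}/(1−s) +
∫_λ^∞ f(t)t^{−s}dt`"). [cite: Burnol2004, proof of Thm. 6.10 (= Burnol2004b Prop. 2.2), TeX l.2436–2441] -/
private theorem mellin_eq_const_add_mellin_trunc {c : ℂ} (hfc : ∀ᵐ x : ℝ, x ∈ Ioo (-a) a → f x = c)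
    {w : ℂ} (hw0 : 0 < w.re) (hw : w.re < 1 / 2) :
    mellin (f : ℝ → ℂ) w = c * (a : ℂ) ^ w / w + mellin (g : ℝ → ℂ) w := by
  have hw1 : -1 < (w - 1).re := by simp; linarith
  have hwne : w ≠ 0 := fun h ↦ by simp [h] at hw0
  have hIoc : IntegrableOn (fun t : ℝ ↦ (t : ℂ) ^ (w - 1)) (Ioc 0 a) :=
    (intervalIntegral.intervalIntegrable_cpow' (a := 0) (b := a) hw1).1
  have hI1 : IntegrableOn (fun t : ℝ ↦ c * (t : ℂ) ^ (w - 1)) (Ioo 0 a) :=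
    (hIoc.mono_set Ioo_subset_Ioc_self).const_mul c
  have hI2 := integrableOn_cpow_smul_trunc ha f g hg hw
  have hae : (fun t : ℝ ↦ (t : ℂ) ^ (w - 1) • (f : ℝ → ℂ) t) =ᵐ[volume.restrict (Ioi 0)]
      fun t ↦ (Ioo 0 a).indicator (fun t : ℝ ↦ c * (t : ℂ) ^ (w - 1)) t + (t : ℂ) ^ (w - 1) • g t := by
    filter_upwards [ae_restrict_mem measurableSet_Ioi, ae_restrict_of_ae (s := Ioi 0) hg,
      ae_restrict_of_ae (s := Ioi 0) hfc, ae_restrict_of_ae (s := Ioi 0) (ae_ne a)] with x hx hgx hfx hxa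
    have hx' : (0 : ℝ) < x := hx
    by_cases h : x < a
    · rw [Set.indicator_of_mem (show x ∈ Ioo 0 a from ⟨hx', h⟩), hgx, Set.indicator_of_notMem,
        hfx ⟨by linarith, h⟩, smul_eq_mul, smul_zero, add_zero, mul_comm]
      simp only [mem_setOf_eq, not_lt, abs_of_pos hx']
      exact h.le
    · have h' : a < x := lt_of_le_of_ne (not_lt.1 h) (Ne.symm hxa)
      rw [Set.indicator_of_notMem (fun hm : x ∈ Ioo 0 a ↦ h hm.2), zero_add, hgx, Set.indicator_of_mem]
      simp only [mem_setOf_eq, abs_of_pos hx']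
      exact h'
  rw [mellin, integral_congr_ae hae,
    integral_add ((hI1.integrable_indicator measurableSet_Ioo).integrableOn (s := Ioi 0)) hI2,
    integral_indicator measurableSet_Ioo, mellin]
  congr 1
  rw [Measure.restrict_restrict measurableSet_Ioo,
    show Ioo 0 a ∩ Ioi 0 = Ioo 0 a from inter_eq_left.2 Ioo_subset_Ioi_self, integral_const_mul,
    ← integral_Ioc_eq_integral_Ioo, ← intervalIntegral.integral_of_le ha.le, integral_cpow (Or.inl hw1),
    sub_add_cancel, Complex.ofReal_zero, Complex.zero_cpow hwne, sub_zero, mul_div_assoc]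

include ha hg in
/-- `ĝ(w) = ½∫_ℝ f·g_w` for `Re w < 1/2` (`g·g_w = f·g_w`). [cite: Burnol2001CRAS, eq. (1.2) (TeX l.320–332)] -/
private theorem mellin_trunc_eq_half_integral (heven : ∀ᵐ x : ℝ, f (-x) = f x) {w : ℂ}
    (hw : w.re < 1 / 2) :
    mellin (g : ℝ → ℂ) w = 1 / 2 * ∫ x, (f : ℝ → ℂ) x *
      Set.indicator {x : ℝ | a < |x|} (fun x : ℝ ↦ ((|x| : ℝ) : ℂ) ^ (w - 1)) x := by
  rw [mellin_eq_half_integral ha g (trunc_even f g hg heven) (trunc_ae_zero f g hg) hw]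
  congr 1
  refine integral_congr_ae ?_
  filter_upwards [hg] with x hx
  rw [hx]
  simp only [Set.indicator, mem_setOf_eq]
  split_ifs <;> simp

end Trunc

/-! ### C. The pairing `∫ f·g_w` on the Fourier side (`Re w < 0`) -/

/-- **`½∫ f·g_w = c'·∫_0^a C_a(u,w)du + ∫_a^∞ 𝓕f(u)C_a(u,w)du`** for even `f ∈ L²` with `𝓕f = c'` a.e.
on `(−a,a)` and `Re w < 0`: the multiplication formula `∫ f·g_w = ∫ 𝓕𝓕f·g_w = ∫ 𝓕f·𝓕g_w`,
`𝓕g_w = C_a(·,w)` (`fourierIntegral_gw`), evenness, and the split `(0,∞) = (0,a] ∪ (a,∞)` ("Moreover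
`𝓕₊(f)(u)` is a constant in the interval `(0,λ)`", TeX l.2453–2454).
[cite: Burnol2004, proof of Thm. 6.10 (TeX l.2442–2456); Burnol2001CRAS, eq. (1.2) (TeX l.320–332)] -/
private theorem half_integral_mul_gw_eq {a : ℝ} (ha : 0 < a) (f : Lp ℂ 2 (volume : Measure ℝ))
    (heven : ∀ᵐ x : ℝ, f (-x) = f x) {c' : ℂ}
    (hFc : ∀ᵐ x : ℝ, x ∈ Ioo (-a) a → (𝓕 f : Lp ℂ 2 (volume : Measure ℝ)) x = c')
    {w : ℂ} (hw : w.re < 0) :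
    1 / 2 * ∫ x, (f : ℝ → ℂ) x *
        Set.indicator {x : ℝ | a < |x|} (fun x : ℝ ↦ ((|x| : ℝ) : ℂ) ^ (w - 1)) x =
      c' * (∫ u in Ioc 0 a, cosKernel a u w) +
        sonineMellinExt a a ((𝓕 f : Lp ℂ 2 (volume : Measure ℝ)) : ℝ → ℂ) w := by
  have hg1 := integrable_gw ha hw
  have hg2 := memLp_gw ha (by linarith : w.re < 1 / 2)
  set G : Lp ℂ 2 (volume : Measure ℝ) :=
    hg2.toLp (Set.indicator {x : ℝ | a < |x|} (fun x : ℝ ↦ ((|x| : ℝ) : ℂ) ^ (w - 1))) with hGdef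
  have hGcoe : (G : ℝ → ℂ) =ᵐ[volume]
      Set.indicator {x : ℝ | a < |x|} (fun x : ℝ ↦ ((|x| : ℝ) : ℂ) ^ (w - 1)) := hg2.coeFn_toLp
  have hFG : ((𝓕 G : Lp ℂ 2 (volume : Measure ℝ)) : ℝ → ℂ) =ᵐ[volume] fun u ↦ cosKernel a u w := by
    filter_upwards [Literature.Analysis.FunctionSpaces.fourier_toLp_ae_eq_fourierIntegral hg1 hg2,
      ae_ne_zero] with u hu hu0
    rw [hu, fourierIntegral_gw ha hw hu0]
  set F : Lp ℂ 2 (volume : Measure ℝ) := 𝓕 f with hFdef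
  have hff : (𝓕 F : Lp ℂ 2 (volume : Measure ℝ)) = f := fourier_fourier_eq_self_of_mem_evenL2 heven
  have hFeven : ∀ᵐ x : ℝ, (F : ℝ → ℂ) (-x) = (F : ℝ → ℂ) x := fourierL2_even heven
  -- multiplication formula
  have e1 : ∫ x, (f : ℝ → ℂ) x *
      Set.indicator {x : ℝ | a < |x|} (fun x : ℝ ↦ ((|x| : ℝ) : ℂ) ^ (w - 1)) x =
      ∫ u, (F : ℝ → ℂ) u * cosKernel a u w := by
    calc ∫ x, (f : ℝ → ℂ) x *
          Set.indicator {x : ℝ | a < |x|} (fun x : ℝ ↦ ((|x| : ℝ) : ℂ) ^ (w - 1)) x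
        = ∫ x, ((𝓕 F : Lp ℂ 2 (volume : Measure ℝ)) : ℝ → ℂ) x * (G : ℝ → ℂ) x := by
          rw [hff]
          refine integral_congr_ae ?_
          filter_upwards [hGcoe] with x hx
          rw [hx]
      _ = ∫ x, (F : ℝ → ℂ) x * ((𝓕 G : Lp ℂ 2 (volume : Measure ℝ)) : ℝ → ℂ) x :=
          Literature.Analysis.Fourier.integral_fourier_mul_eq (V := ℝ) F G
      _ = ∫ u, (F : ℝ → ℂ) u * cosKernel a u w := by
          refine integral_congr_ae ?_
          filter_upwards [hFG] with x hx
          rw [hx]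
  -- integrability and evenness of `F·C_a(·,w)`
  have hint : Integrable (fun u ↦ (F : ℝ → ℂ) u * cosKernel a u w) := by
    have : Integrable (fun x ↦ (F : ℝ → ℂ) x * ((𝓕 G : Lp ℂ 2 (volume : Measure ℝ)) : ℝ → ℂ) x) :=
      (Lp.memLp F).integrable_mul (Lp.memLp _)
    refine this.congr ?_
    filter_upwards [hFG] with x hx
    rw [hx]
  have hev : ∀ᵐ u : ℝ, (F : ℝ → ℂ) (-u) * cosKernel a (-u) w = (F : ℝ → ℂ) u * cosKernel a u w := by
    filter_upwards [hFeven] with u hu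
    rw [hu, cosKernel_neg]
  rw [e1, integral_eq_two_mul_integral_Ioi_zero hint hev]
  have hI : IntegrableOn (fun u ↦ (F : ℝ → ℂ) u * cosKernel a u w) (Ioi 0) := hint.integrableOn
  rw [← Ioc_union_Ioi_eq_Ioi ha.le, setIntegral_union (Set.Ioc_disjoint_Ioi le_rfl) measurableSet_Ioi
    (hI.mono_set Ioc_subset_Ioi_self) (hI.mono_set (Ioi_subset_Ioi ha.le)), sonineMellinExt]
  have e2 : ∫ u in Ioc 0 a, (F : ℝ → ℂ) u * cosKernel a u w = c' * ∫ u in Ioc 0 a, cosKernel a u w := by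
    rw [← integral_const_mul]
    refine setIntegral_congr_ae measurableSet_Ioc ?_
    filter_upwards [hFc, ae_ne a] with u hu hua huI
    rw [hu ⟨by linarith [huI.1], lt_of_le_of_ne huI.2 hua⟩]
  rw [e2]
  ring


/-! ### D. `∫_0^a C_a(u,w)du` is the entire sine moment `(J(2πa,a,w−2) − J(−2πa,a,w−2))/(2πi)` -/

/-- `e^{iλt} t^z` is integrable on `(a,∞)`, `a > 0`, when `Re z < −1`. [folklore] -/
private theorem integrableOn_cexp_mul_cpow (l : ℝ) {a : ℝ} (ha : 0 < a) {z : ℂ} (hz : z.re < -1) :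
    IntegrableOn (fun t : ℝ ↦ cexp (I * l * t) * (t : ℂ) ^ z) (Ioi a) := by
  refine (integrableOn_Ioi_cpow_of_lt hz ha).bdd_mul (c := 1)
    (Continuous.aestronglyMeasurable (by fun_prop)) (Eventually.of_forall fun t ↦ ?_)
  rw [show (I * l * t : ℂ) = ((l * t : ℝ) : ℂ) * I by push_cast; ring, Complex.norm_exp_ofReal_mul_I]

/-- `Q₀(2πt,a) + Q₀(−2πt,a) = (e^{2πiat} − e^{−2πiat})/(2πit)` and hence, times `t^{w−1}`,
`= (e^{2πiat} − e^{−2πiat})t^{w−2}/(2πi)` (`t > 0`). [cite: Burnol2001CRAS, Lemme 1.3 (TeX l.358–367)] -/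
private theorem oscMoment_zero_add_mul_cpow {a t : ℝ} (ht : 0 < t) (w : ℂ) :
    (oscMoment (2 * π * t) a 0 + oscMoment (-(2 * π * t)) a 0) * (t : ℂ) ^ (w - 1) =
      (cexp (I * (2 * π * a : ℝ) * t) * (t : ℂ) ^ (w - 2) -
        cexp (I * (-(2 * π * a) : ℝ) * t) * (t : ℂ) ^ (w - 2)) / (2 * π * I) := by
  have h1 : (2 * π * t : ℝ) ≠ 0 := by positivity
  have h2 : (-(2 * π * t) : ℝ) ≠ 0 := neg_ne_zero.2 h1
  have ht' : (t : ℂ) ≠ 0 := ofReal_ne_zero.2 ht.ne'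
  have hπ : (π : ℂ) ≠ 0 := ofReal_ne_zero.2 Real.pi_pos.ne'
  have hcp : (t : ℂ) ^ (w - 1) = (t : ℂ) ^ (w - 2) * t := by
    rw [show w - 1 = (w - 2) + 1 by ring, cpow_add _ _ ht', cpow_one]
  rw [oscMoment_zero h1, oscMoment_zero h2, hcp]
  push_cast
  rw [show (I * (2 * π * t) * a : ℂ) = I * (2 * π * a) * t by ring,
    show (I * -(2 * π * t) * a : ℂ) = I * -(2 * π * a) * t by ring]
  field_simp
  ring

/-- **`∫_0^a C_a(u,w)du = (J(2πa,a,w−2) − J(−2πa,a,w−2))/(2πi)`** for `Re w < 0`: by the multiplication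
formula against `𝟙_{(−a,a)}` (`𝓕𝟙_{(−a,a)}(t) = Q₀(2πt,a) + Q₀(−2πt,a) = sin(2πat)/(πt)`),
`∫_{−a}^a C_a(u,w)du = ∫_{|t|>a} (sin(2πat)/(πt))|t|^{w−1}dt = (1/π)·2∫_a^∞ sin(2πat)t^{w−2}dt`; the
last integral continues to the entire function of the statement (the integration-by-parts continuation
`ibpEntire` of `BurnolCosineKernelEntire.lean`). This is the contribution "`χ₊(s)λ^s/s + …`" of the constant
value of `𝓕₊(f)` on `(0,λ)` in the printed proof. [cite: Burnol2004, proof of Thm. 6.10 (TeX l.2448–2456); Burnol2001CRAS, Lemme 1.3 (TeX l.358–367)] -/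
private theorem setIntegral_Ioc_cosKernel {a : ℝ} (ha : 0 < a) {w : ℂ} (hw : w.re < 0) :
    ∫ u in Ioc 0 a, cosKernel a u w =
      (ibpEntire (2 * π * a) a (w - 2) - ibpEntire (-(2 * π * a)) a (w - 2)) / (2 * π * I) := by
  -- the kernel class `G` of `g_w`, with `𝓕 G = C_a(·,w)`
  have hg1 := integrable_gw ha hw
  have hg2 := memLp_gw ha (by linarith : w.re < 1 / 2)
  set G : Lp ℂ 2 (volume : Measure ℝ) :=
    hg2.toLp (Set.indicator {x : ℝ | a < |x|} (fun x : ℝ ↦ ((|x| : ℝ) : ℂ) ^ (w - 1))) with hGdef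
  have hGcoe : (G : ℝ → ℂ) =ᵐ[volume]
      Set.indicator {x : ℝ | a < |x|} (fun x : ℝ ↦ ((|x| : ℝ) : ℂ) ^ (w - 1)) := hg2.coeFn_toLp
  have hFG : ((𝓕 G : Lp ℂ 2 (volume : Measure ℝ)) : ℝ → ℂ) =ᵐ[volume] fun u ↦ cosKernel a u w := by
    filter_upwards [Literature.Analysis.FunctionSpaces.fourier_toLp_ae_eq_fourierIntegral hg1 hg2,
      ae_ne_zero] with u hu hu0
    rw [hu, fourierIntegral_gw ha hw hu0]
  -- the indicator class `H` of `(−a, a)`, with `𝓕 H = Q₀(2π·,a) + Q₀(−2π·,a)`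
  set h0 : ℝ → ℂ := Set.indicator {x : ℝ | |x| < a} (fun x : ℝ ↦ (x : ℂ) ^ (2 * 0)) with hh0
  have hh0' : h0 = Set.indicator (Ioo (-a) a) (fun _ ↦ (1 : ℂ)) := by
    rw [hh0]
    have hs : {x : ℝ | |x| < a} = Ioo (-a) a := by ext x; simp [abs_lt]
    rw [hs]
    ext x
    simp [Set.indicator]
  have hvol : volume (Ioo (-a) a) ≠ ∞ := by simp [Real.volume_Ioo]
  have hh1 : Integrable h0 := by
    rw [hh0', integrable_indicator_iff measurableSet_Ioo]
    exact integrableOn_const hvol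
  have hh2 : MemLp h0 2 volume := by
    rw [hh0']
    exact memLp_indicator_const 2 measurableSet_Ioo (1 : ℂ) (Or.inr hvol)
  set H : Lp ℂ 2 (volume : Measure ℝ) := hh2.toLp h0 with hHdef
  have hHcoe : (H : ℝ → ℂ) =ᵐ[volume] h0 := hh2.coeFn_toLp
  have hFH : ((𝓕 H : Lp ℂ 2 (volume : Measure ℝ)) : ℝ → ℂ) =ᵐ[volume]
      fun t ↦ oscMoment (2 * π * t) a 0 + oscMoment (-(2 * π * t)) a 0 := by
    filter_upwards [Literature.Analysis.FunctionSpaces.fourier_toLp_ae_eq_fourierIntegral hh1 hh2]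
      with t ht
    rw [ht, hh0, fourierIntegral_hj ha 0 t]
  -- the multiplication formula `∫ H·𝓕G = ∫ 𝓕H·G`
  have hP := Literature.Analysis.Fourier.integral_mul_fourier_eq (V := ℝ) H G
  -- left side: `∫_{(−a,a)} C_a(u,w) du = 2∫_{(0,a]} C_a(u,w) du`
  have hL : ∫ x, (H : ℝ → ℂ) x * ((𝓕 G : Lp ℂ 2 (volume : Measure ℝ)) : ℝ → ℂ) x =
      2 * ∫ u in Ioc 0 a, cosKernel a u w := by
    have e1 : ∫ x, (H : ℝ → ℂ) x * ((𝓕 G : Lp ℂ 2 (volume : Measure ℝ)) : ℝ → ℂ) x =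
        ∫ x, (Ioo (-a) a).indicator (fun u ↦ cosKernel a u w) x := by
      refine integral_congr_ae ?_
      filter_upwards [hHcoe, hFG] with x h1 h2
      rw [h1, h2, hh0']
      simp only [Set.indicator]
      split_ifs <;> simp
    have hint : Integrable ((Ioo (-a) a).indicator (fun u ↦ cosKernel a u w)) := by
      have : Integrable (fun x ↦ (H : ℝ → ℂ) x * ((𝓕 G : Lp ℂ 2 (volume : Measure ℝ)) : ℝ → ℂ) x) :=
        (Lp.memLp H).integrable_mul (Lp.memLp _)
      refine this.congr ?_
      filter_upwards [hHcoe, hFG] with x h1 h2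
      rw [h1, h2, hh0']
      simp only [Set.indicator]
      split_ifs <;> simp
    have hev : ∀ᵐ x : ℝ, (Ioo (-a) a).indicator (fun u ↦ cosKernel a u w) (-x) =
        (Ioo (-a) a).indicator (fun u ↦ cosKernel a u w) x := by
      refine Eventually.of_forall fun x ↦ ?_
      simp only [Set.indicator, mem_Ioo, cosKernel_neg]
      split_ifs with h1 h2 h2
      · rfl
      · exact absurd ⟨by linarith [h1.2], by linarith [h1.1]⟩ h2
      · exact absurd ⟨by linarith [h2.2], by linarith [h2.1]⟩ h1
      · rfl
    rw [e1, integral_eq_two_mul_integral_Ioi_zero hint hev, setIntegral_indicator measurableSet_Ioo,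
      show Ioi (0 : ℝ) ∩ Ioo (-a) a = Ioo 0 a by
        ext x; constructor
        · rintro ⟨h1, h2⟩; exact ⟨h1, h2.2⟩
        · rintro ⟨h1, h2⟩; exact ⟨h1, by linarith, h2⟩,
      integral_Ioc_eq_integral_Ioo]
  -- right side: `∫ (Q₀ + Q₀)·g_w = 2∫_a^∞ (e⁺ − e⁻) t^{w−2}/(2πi) = 2(J₊ − J₋)/(2πi)`
  have hR : ∫ x, ((𝓕 H : Lp ℂ 2 (volume : Measure ℝ)) : ℝ → ℂ) x * (G : ℝ → ℂ) x =
      2 * ((ibpEntire (2 * π * a) a (w - 2) - ibpEntire (-(2 * π * a)) a (w - 2)) / (2 * π * I)) := by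
    set ψ : ℝ → ℂ := fun t ↦ (oscMoment (2 * π * t) a 0 + oscMoment (-(2 * π * t)) a 0) *
      Set.indicator {x : ℝ | a < |x|} (fun x : ℝ ↦ ((|x| : ℝ) : ℂ) ^ (w - 1)) t with hψ
    have e1 : ∫ x, ((𝓕 H : Lp ℂ 2 (volume : Measure ℝ)) : ℝ → ℂ) x * (G : ℝ → ℂ) x = ∫ t, ψ t := by
      refine integral_congr_ae ?_
      filter_upwards [hFH, hGcoe] with t h1 h2
      rw [h1, h2]
    have hint : Integrable ψ := by
      have : Integrable (fun x ↦ ((𝓕 H : Lp ℂ 2 (volume : Measure ℝ)) : ℝ → ℂ) x * (G : ℝ → ℂ) x) :=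
        (Lp.memLp _).integrable_mul (Lp.memLp G)
      refine this.congr ?_
      filter_upwards [hFH, hGcoe] with t h1 h2
      rw [h1, h2]
    have hev : ∀ᵐ t : ℝ, ψ (-t) = ψ t := by
      refine Eventually.of_forall fun t ↦ ?_
      rw [hψ]
      simp only [gw_neg]
      rw [show (2 * π * -t : ℝ) = -(2 * π * t) by ring, neg_neg, add_comm]
    rw [e1, integral_eq_two_mul_integral_Ioi_zero hint hev]
    congr 1
    have e2 : ∫ t in Ioi 0, ψ t = ∫ t in Ioi 0, (Ioi a).indicator (fun t : ℝ ↦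
        (cexp (I * (2 * π * a : ℝ) * t) * (t : ℂ) ^ (w - 2) -
          cexp (I * (-(2 * π * a) : ℝ) * t) * (t : ℂ) ^ (w - 2)) / (2 * π * I)) t := by
      refine setIntegral_congr_fun measurableSet_Ioi fun t (ht : 0 < t) ↦ ?_
      rw [hψ]
      simp only
      rw [gw_eq_indicator_of_pos a w ht]
      by_cases hta : a < t
      · rw [Set.indicator_of_mem (show t ∈ Ioi a from hta), Set.indicator_of_mem (show t ∈ Ioi a from hta),
          oscMoment_zero_add_mul_cpow ht w]
      · rw [Set.indicator_of_notMem (show t ∉ Ioi a from hta),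
          Set.indicator_of_notMem (show t ∉ Ioi a from hta), mul_zero]
    rw [e2, setIntegral_indicator measurableSet_Ioi,
      show Ioi (0 : ℝ) ∩ Ioi a = Ioi a from inter_eq_right.2 (Ioi_subset_Ioi ha.le)]
    have hz : (w - 2).re < -1 := by simp; linarith
    have hi1 := integrableOn_cexp_mul_cpow (2 * π * a) ha hz
    have hi2 := integrableOn_cexp_mul_cpow (-(2 * π * a)) ha hz
    have hl : (2 * π * a : ℝ) ≠ 0 := by positivity
    rw [integral_div, integral_sub hi1 hi2, ← ibpEntire_eq_integral hl ha hz,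
      ← ibpEntire_eq_integral (neg_ne_zero.2 hl) ha hz]
  have h := hP
  rw [hL, hR] at h
  exact mul_left_cancel₀ two_ne_zero h


/-! ### E. Identity theorem: `ĝ(w) = c'·Ẽ_a(w) + ∫_a^∞ 𝓕f·C_a(·,w)` on the whole half-plane `Re w < 1/2` -/

section Trunc2

variable {a : ℝ} (ha : 0 < a) (f g : Lp ℂ 2 (volume : Measure ℝ))
  (hg : ∀ᵐ x : ℝ, g x = Set.indicator {x : ℝ | a < |x|} (f : ℝ → ℂ) x)
  (heven : ∀ᵐ x : ℝ, f (-x) = f x) {c' : ℂ}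
  (hFc : ∀ᵐ x : ℝ, x ∈ Ioo (-a) a → (𝓕 f : Lp ℂ 2 (volume : Measure ℝ)) x = c')

include ha hg heven hFc in
/-- **`ĝ(w) = c'·(J(2πa,a,w−2) − J(−2πa,a,w−2))/(2πi) + ∫_a^∞ 𝓕f(u)C_a(u,w)du` for `Re w < 1/2`**: both
sides are holomorphic on the half-plane (`differentiableOn_mellin`; `differentiable_ibpEntire`,
`differentiable_sonineMellinExt`) and they agree on `Re w < 0` (§§C, D) — "Combining these informations
we get that the above displayed equation has an analytic continuation" (TeX l.2454–2456).
[cite: Burnol2004, proof of Thm. 6.10 (TeX l.2442–2456)] -/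
private theorem mellin_trunc_eq {w : ℂ} (hw : w.re < 1 / 2) :
    mellin (g : ℝ → ℂ) w =
      c' * ((ibpEntire (2 * π * a) a (w - 2) - ibpEntire (-(2 * π * a)) a (w - 2)) / (2 * π * I)) +
        sonineMellinExt a a ((𝓕 f : Lp ℂ 2 (volume : Measure ℝ)) : ℝ → ℂ) w := by
  set R : ℂ → ℂ := fun w ↦
    c' * ((ibpEntire (2 * π * a) a (w - 2) - ibpEntire (-(2 * π * a)) a (w - 2)) / (2 * π * I)) +
      sonineMellinExt a a ((𝓕 f : Lp ℂ 2 (volume : Measure ℝ)) : ℝ → ℂ) w with hR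
  have hl : (2 * π * a : ℝ) ≠ 0 := by positivity
  have hRd : Differentiable ℂ R := by
    have h1 := (differentiable_ibpEntire hl ha).comp (differentiable_id.sub_const (2 : ℂ))
    have h2 := (differentiable_ibpEntire (neg_ne_zero.2 hl) ha).comp (differentiable_id.sub_const (2 : ℂ))
    have h3 := differentiable_sonineMellinExt ha ha (𝓕 f : Lp ℂ 2 (volume : Measure ℝ))
    exact (((h1.sub h2).div_const _).const_mul _).add h3
  have hopen : IsOpen {w : ℂ | w.re < 1 / 2} := isOpen_lt Complex.continuous_re continuous_const
  have hconn : IsPreconnected {w : ℂ | w.re < 1 / 2} := (convex_halfSpace_re_lt (1 / 2)).isPreconnected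
  have hM : AnalyticOnNhd ℂ (mellin (g : ℝ → ℂ)) {w : ℂ | w.re < 1 / 2} :=
    (differentiableOn_mellin ha g (trunc_ae_zero f g hg)).analyticOnNhd hopen
  have hRa : AnalyticOnNhd ℂ R {w : ℂ | w.re < 1 / 2} := hRd.differentiableOn.analyticOnNhd hopen
  have hm1 : (-1 : ℂ) ∈ {w : ℂ | w.re < 1 / 2} := by simp only [mem_setOf_eq]; norm_num
  have hev : mellin (g : ℝ → ℂ) =ᶠ[𝓝 (-1 : ℂ)] R := by
    have hO : IsOpen {w : ℂ | w.re < 0} := isOpen_lt Complex.continuous_re continuous_const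
    have hm : (-1 : ℂ) ∈ {w : ℂ | w.re < 0} := by simp only [mem_setOf_eq]; norm_num
    filter_upwards [hO.mem_nhds hm] with w hw'
    have hw0 : w.re < 0 := hw'
    rw [hR]
    simp only
    rw [mellin_trunc_eq_half_integral ha f g hg heven (by linarith : w.re < 1 / 2),
      half_integral_mul_gw_eq ha f heven hFc hw0, setIntegral_Ioc_cosKernel ha hw0]
  exact hM.eqOn_of_preconnected_of_eventuallyEq hRa hconn hm1 hev hw

end Trunc2

/-! ### F. The trivial zeros: values at `w = 1 + 2j` -/

/-- `h_j = x^{2j}𝟙_{|x|<a}` is integrable. [folklore] -/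
private theorem integrable_hj (a : ℝ) (j : ℕ) :
    Integrable (Set.indicator {x : ℝ | |x| < a} (fun x : ℝ ↦ (x : ℂ) ^ (2 * j))) := by
  have hs : {x : ℝ | |x| < a} = Ioo (-a) a := by ext x; simp [abs_lt]
  rw [hs, integrable_indicator_iff measurableSet_Ioo]
  exact ((by fun_prop : Continuous fun x : ℝ ↦ (x : ℂ) ^ (2 * j)).integrableOn_Icc).mono_set
    Ioo_subset_Icc_self

/-- `h_j ∈ L²(ℝ)`. [folklore] -/
private theorem memLp_hj (a : ℝ) (j : ℕ) :
    MemLp (Set.indicator {x : ℝ | |x| < a} (fun x : ℝ ↦ (x : ℂ) ^ (2 * j))) 2 volume := by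
  have hs : {x : ℝ | |x| < a} = Ioo (-a) a := by ext x; simp [abs_lt]
  have hmeas : Measurable (Set.indicator {x : ℝ | |x| < a} (fun x : ℝ ↦ (x : ℂ) ^ (2 * j))) := by
    refine Measurable.indicator (Complex.measurable_ofReal.pow_const _) ?_
    rw [hs]; exact measurableSet_Ioo
  rw [memLp_two_iff_integrable_sq_norm hmeas.aestronglyMeasurable]
  have h : (fun x ↦ ‖(Set.indicator {x : ℝ | |x| < a} (fun x : ℝ ↦ (x : ℂ) ^ (2 * j))) x‖ ^ 2) =
      Set.indicator {x : ℝ | |x| < a} (fun x : ℝ ↦ (x ^ 2) ^ (2 * j)) := by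
    ext x
    simp only [Set.indicator, mem_setOf_eq]
    split_ifs
    · rw [norm_pow, Complex.norm_real, Real.norm_eq_abs, ← pow_mul, ← sq_abs, ← pow_mul]; ring_nf
    · simp
  rw [h, hs, integrable_indicator_iff measurableSet_Ioo]
  exact ((by fun_prop : Continuous fun x : ℝ ↦ (x ^ 2) ^ (2 * j)).integrableOn_Icc).mono_set
    Ioo_subset_Icc_self

/-- `∫_{−a}^a c·x^{2j} dx = 2c·a^{2j+1}/(2j+1)` (complex-valued). [folklore] -/
private theorem integral_indicator_const_mul_pow {a : ℝ} (ha : 0 < a) (c : ℂ) (j : ℕ) :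
    ∫ x, (Ioo (-a) a).indicator (fun x : ℝ ↦ c * (x : ℂ) ^ (2 * j)) x =
      2 * (c * (a : ℂ) ^ (2 * j + 1) / (2 * j + 1)) := by
  rw [integral_indicator measurableSet_Ioo, integral_const_mul, ← integral_Ioc_eq_integral_Ioo,
    ← intervalIntegral.integral_of_le (by linarith : -a ≤ a)]
  have e1 : ∫ x in (-a)..a, (x : ℂ) ^ (2 * j) = (((∫ x in (-a)..a, x ^ (2 * j) : ℝ)) : ℂ) := by
    rw [← intervalIntegral.integral_ofReal]
    push_cast
    rfl
  rw [e1, integral_pow]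
  have e2 : (-a) ^ (2 * j + 1) = -(a ^ (2 * j + 1)) := Odd.neg_pow ⟨j, rfl⟩ a
  rw [e2]
  push_cast
  ring

/-- `(Q₀(2πt,a) + Q₀(−2πt,a))·t^{n+1} = (e^{2πiat} − e^{−2πiat})t^n/(2πi)` (`t ≠ 0`).
[cite: Burnol2001CRAS, Lemme 1.3 (TeX l.358–367)] -/
private theorem oscMoment_zero_add_mul_pow {a t : ℝ} (ht : t ≠ 0) (n : ℕ) :
    (oscMoment (2 * π * t) a 0 + oscMoment (-(2 * π * t)) a 0) * (t : ℂ) ^ (n + 1) =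
      (cexp (I * (2 * π * a : ℝ) * t) * (t : ℂ) ^ n -
        cexp (I * (-(2 * π * a) : ℝ) * t) * (t : ℂ) ^ n) / (2 * π * I) := by
  have h1 : (2 * π * t : ℝ) ≠ 0 := by positivity
  have h2 : (-(2 * π * t) : ℝ) ≠ 0 := neg_ne_zero.2 h1
  have ht' : (t : ℂ) ≠ 0 := ofReal_ne_zero.2 ht
  have hπ : (π : ℂ) ≠ 0 := ofReal_ne_zero.2 Real.pi_pos.ne'
  rw [oscMoment_zero h1, oscMoment_zero h2, pow_succ]
  push_cast
  rw [show (I * (2 * π * t) * a : ℂ) = I * (2 * π * a) * t by ring,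
    show (I * -(2 * π * t) * a : ℂ) = I * -(2 * π * a) * t by ring]
  field_simp
  ring

/-- **Terminating integration by parts at ODD integers**:
`J(λ,a,2k+1) − J(−λ,a,2k+1) = −(Q_{2k+1}(λ,a) − Q_{2k+1}(−λ,a))` (the two `t = 0` boundary terms
`c_{2k+1}(2k+1)(±λ)/(±iλ)` coincide). Twin of `ibpEntire_add_ibpEntire_neg_even`.
[cite: Burnol2001CRAS, Lemme 1.3 (TeX l.358–367)] -/
private theorem ibpEntire_sub_ibpEntire_neg_odd {l a : ℝ} (hl : l ≠ 0) (ha : 0 < a) (k : ℕ) :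
    ibpEntire l a ((2 * k + 1 : ℕ) : ℂ) - ibpEntire (-l) a ((2 * k + 1 : ℕ) : ℂ) =
      -(oscMoment l a (2 * k + 1) - oscMoment (-l) a (2 * k + 1)) := by
  have hl' : -l ≠ 0 := neg_ne_zero.mpr hl
  have hIl : (I * l : ℂ) ≠ 0 := mul_ne_zero I_ne_zero (ofReal_ne_zero.mpr hl)
  rw [ibpEntire_natCast hl ha, ibpEntire_natCast hl' ha, oscMoment_eq hl a, oscMoment_eq hl' a,
    ibpCoef_neg]
  have : ((-1 : ℂ)) ^ (2 * k + 1) = -1 := by rw [pow_succ, pow_mul]; simp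
  rw [this]
  push_cast
  field_simp
  ring

/-- **`∫_0^a D_a(u, 2k+3) du = (Q_{2k+1}(2πa,a) − Q_{2k+1}(−2πa,a))/(2πi)`**, where
`D_a(u,1+2j) = 𝓕(x^{2j}𝟙_{|x|<a})(u) = Q_{2j}(2πu,a) + Q_{2j}(−2πu,a)`, `j = k+1`: by the multiplication
formula against `𝟙_{(−a,a)}`, `∫_{−a}^a 𝓕h_j = ∫ 𝓕𝟙_{(−a,a)}·h_j = ∫_{−a}^a (sin(2πat)/(πt))t^{2j}dt`.
[cite: Burnol2001CRAS, Lemme 1.3 (TeX l.358–367)] -/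
private theorem setIntegral_Ioc_fourier_hj {a : ℝ} (ha : 0 < a) (k : ℕ) :
    ∫ u in Ioc 0 a, (oscMoment (2 * π * u) a (2 * (k + 1)) + oscMoment (-(2 * π * u)) a (2 * (k + 1))) =
      (oscMoment (2 * π * a) a (2 * k + 1) - oscMoment (-(2 * π * a)) a (2 * k + 1)) / (2 * π * I) := by
  -- the class `Hj` of `h_{k+1}` and its Fourier transform
  have hh1 := integrable_hj a (k + 1)
  have hh2 := memLp_hj a (k + 1)
  set Hj : Lp ℂ 2 (volume : Measure ℝ) :=
    hh2.toLp (Set.indicator {x : ℝ | |x| < a} (fun x : ℝ ↦ (x : ℂ) ^ (2 * (k + 1)))) with hHjdef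
  have hHjcoe : (Hj : ℝ → ℂ) =ᵐ[volume]
      Set.indicator {x : ℝ | |x| < a} (fun x : ℝ ↦ (x : ℂ) ^ (2 * (k + 1))) := hh2.coeFn_toLp
  have hFHj : ((𝓕 Hj : Lp ℂ 2 (volume : Measure ℝ)) : ℝ → ℂ) =ᵐ[volume]
      fun u ↦ oscMoment (2 * π * u) a (2 * (k + 1)) + oscMoment (-(2 * π * u)) a (2 * (k + 1)) := by
    filter_upwards [Literature.Analysis.FunctionSpaces.fourier_toLp_ae_eq_fourierIntegral hh1 hh2]
      with u hu
    rw [hu, fourierIntegral_hj ha (k + 1) u]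
  -- the indicator class `H` of `(−a,a)`
  set h0 : ℝ → ℂ := Set.indicator {x : ℝ | |x| < a} (fun x : ℝ ↦ (x : ℂ) ^ (2 * 0)) with hh0
  have hs : {x : ℝ | |x| < a} = Ioo (-a) a := by ext x; simp [abs_lt]
  have hh0' : h0 = Set.indicator (Ioo (-a) a) (fun _ ↦ (1 : ℂ)) := by
    rw [hh0, hs]
    ext x
    simp [Set.indicator]
  have hvol : volume (Ioo (-a) a) ≠ ∞ := by simp [Real.volume_Ioo]
  have hh01 : Integrable h0 := by
    rw [hh0', integrable_indicator_iff measurableSet_Ioo]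
    exact integrableOn_const hvol
  have hh02 : MemLp h0 2 volume := by
    rw [hh0']
    exact memLp_indicator_const 2 measurableSet_Ioo (1 : ℂ) (Or.inr hvol)
  set H : Lp ℂ 2 (volume : Measure ℝ) := hh02.toLp h0 with hHdef
  have hHcoe : (H : ℝ → ℂ) =ᵐ[volume] h0 := hh02.coeFn_toLp
  have hFH : ((𝓕 H : Lp ℂ 2 (volume : Measure ℝ)) : ℝ → ℂ) =ᵐ[volume]
      fun t ↦ oscMoment (2 * π * t) a 0 + oscMoment (-(2 * π * t)) a 0 := by
    filter_upwards [Literature.Analysis.FunctionSpaces.fourier_toLp_ae_eq_fourierIntegral hh01 hh02]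
      with t ht
    rw [ht, hh0, fourierIntegral_hj ha 0 t]
  have hP := Literature.Analysis.Fourier.integral_mul_fourier_eq (V := ℝ) H Hj
  -- left side
  have hL : ∫ x, (H : ℝ → ℂ) x * ((𝓕 Hj : Lp ℂ 2 (volume : Measure ℝ)) : ℝ → ℂ) x =
      2 * ∫ u in Ioc 0 a,
        (oscMoment (2 * π * u) a (2 * (k + 1)) + oscMoment (-(2 * π * u)) a (2 * (k + 1))) := by
    set D : ℝ → ℂ := fun u ↦
      oscMoment (2 * π * u) a (2 * (k + 1)) + oscMoment (-(2 * π * u)) a (2 * (k + 1)) with hD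
    have e1 : ∫ x, (H : ℝ → ℂ) x * ((𝓕 Hj : Lp ℂ 2 (volume : Measure ℝ)) : ℝ → ℂ) x =
        ∫ x, (Ioo (-a) a).indicator D x := by
      refine integral_congr_ae ?_
      filter_upwards [hHcoe, hFHj] with x h1 h2
      rw [h1, h2, hh0', hD]
      simp only [Set.indicator]
      split_ifs <;> simp
    have hint : Integrable ((Ioo (-a) a).indicator D) := by
      have : Integrable (fun x ↦ (H : ℝ → ℂ) x * ((𝓕 Hj : Lp ℂ 2 (volume : Measure ℝ)) : ℝ → ℂ) x) :=
        (Lp.memLp H).integrable_mul (Lp.memLp _)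
      refine this.congr ?_
      filter_upwards [hHcoe, hFHj] with x h1 h2
      rw [h1, h2, hh0', hD]
      simp only [Set.indicator]
      split_ifs <;> simp
    have hDev : ∀ u, D (-u) = D u := fun u ↦ by
      rw [hD]; simp only
      rw [show (2 * π * -u : ℝ) = -(2 * π * u) by ring, neg_neg, add_comm]
    have hev : ∀ᵐ x : ℝ, (Ioo (-a) a).indicator D (-x) = (Ioo (-a) a).indicator D x := by
      refine Eventually.of_forall fun x ↦ ?_
      simp only [Set.indicator, mem_Ioo, hDev]
      split_ifs with h1 h2 h2
      · rfl
      · exact absurd ⟨by linarith [h1.2], by linarith [h1.1]⟩ h2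
      · exact absurd ⟨by linarith [h2.2], by linarith [h2.1]⟩ h1
      · rfl
    rw [e1, integral_eq_two_mul_integral_Ioi_zero hint hev, setIntegral_indicator measurableSet_Ioo,
      show Ioi (0 : ℝ) ∩ Ioo (-a) a = Ioo 0 a by
        ext x; constructor
        · rintro ⟨h1, h2⟩; exact ⟨h1, h2.2⟩
        · rintro ⟨h1, h2⟩; exact ⟨h1, by linarith, h2⟩,
      integral_Ioc_eq_integral_Ioo]
  -- right side
  have hR : ∫ x, ((𝓕 H : Lp ℂ 2 (volume : Measure ℝ)) : ℝ → ℂ) x * (Hj : ℝ → ℂ) x =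
      2 * ((oscMoment (2 * π * a) a (2 * k + 1) - oscMoment (-(2 * π * a)) a (2 * k + 1)) /
        (2 * π * I)) := by
    set ψ : ℝ → ℂ := fun t ↦ (oscMoment (2 * π * t) a 0 + oscMoment (-(2 * π * t)) a 0) *
      Set.indicator {x : ℝ | |x| < a} (fun x : ℝ ↦ (x : ℂ) ^ (2 * (k + 1))) t with hψ
    have e1 : ∫ x, ((𝓕 H : Lp ℂ 2 (volume : Measure ℝ)) : ℝ → ℂ) x * (Hj : ℝ → ℂ) x = ∫ t, ψ t := by
      refine integral_congr_ae ?_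
      filter_upwards [hFH, hHjcoe] with t h1 h2
      rw [h1, h2]
    have hint : Integrable ψ := by
      have : Integrable (fun x ↦ ((𝓕 H : Lp ℂ 2 (volume : Measure ℝ)) : ℝ → ℂ) x * (Hj : ℝ → ℂ) x) :=
        (Lp.memLp _).integrable_mul (Lp.memLp Hj)
      refine this.congr ?_
      filter_upwards [hFH, hHjcoe] with t h1 h2
      rw [h1, h2]
    have hev : ∀ᵐ t : ℝ, ψ (-t) = ψ t := by
      refine Eventually.of_forall fun t ↦ ?_
      rw [hψ]
      simp only [Set.indicator, mem_setOf_eq, abs_neg]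
      rw [show (2 * π * -t : ℝ) = -(2 * π * t) by ring, neg_neg, add_comm]
      split_ifs <;> simp [(even_two_mul (k + 1)).neg_pow]
    rw [e1, integral_eq_two_mul_integral_Ioi_zero hint hev]
    congr 1
    have e2 : ∫ t in Ioi 0, ψ t = ∫ t in Ioi 0, (Ioo 0 a).indicator (fun t : ℝ ↦
        (cexp (I * (2 * π * a : ℝ) * t) * (t : ℂ) ^ (2 * k + 1) -
          cexp (I * (-(2 * π * a) : ℝ) * t) * (t : ℂ) ^ (2 * k + 1)) / (2 * π * I)) t := by
      refine setIntegral_congr_fun measurableSet_Ioi fun t (ht : 0 < t) ↦ ?_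
      rw [hψ]
      simp only
      by_cases hta : t < a
      · have hm : t ∈ {x : ℝ | |x| < a} := by simp [abs_of_pos ht, hta]
        rw [Set.indicator_of_mem hm, Set.indicator_of_mem (show t ∈ Ioo 0 a from ⟨ht, hta⟩),
          show 2 * (k + 1) = (2 * k + 1) + 1 by ring, oscMoment_zero_add_mul_pow ht.ne' (2 * k + 1)]
      · have hm : t ∉ {x : ℝ | |x| < a} := by simp [abs_of_pos ht, not_lt.1 hta]
        rw [Set.indicator_of_notMem hm, Set.indicator_of_notMem (fun h : t ∈ Ioo 0 a ↦ hta h.2),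
          mul_zero]
    have hi1 : IntervalIntegrable (fun t : ℝ ↦ cexp (I * (2 * π * a : ℝ) * t) *
        (t : ℂ) ^ (2 * k + 1)) volume 0 a :=
      (by fun_prop : Continuous fun t : ℝ ↦ cexp (I * (2 * π * a : ℝ) * t) *
        (t : ℂ) ^ (2 * k + 1)).intervalIntegrable _ _
    have hi2 : IntervalIntegrable (fun t : ℝ ↦ cexp (I * (-(2 * π * a) : ℝ) * t) *
        (t : ℂ) ^ (2 * k + 1)) volume 0 a :=
      (by fun_prop : Continuous fun t : ℝ ↦ cexp (I * (-(2 * π * a) : ℝ) * t) *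
        (t : ℂ) ^ (2 * k + 1)).intervalIntegrable _ _
    rw [e2, setIntegral_indicator measurableSet_Ioo,
      show Ioi (0 : ℝ) ∩ Ioo 0 a = Ioo 0 a from inter_eq_right.2 Ioo_subset_Ioi_self,
      ← integral_Ioc_eq_integral_Ioo, ← intervalIntegral.integral_of_le ha.le,
      intervalIntegral.integral_div, intervalIntegral.integral_sub hi1 hi2, oscMoment, oscMoment]
  have h := hP
  rw [hL, hR] at h
  exact mul_left_cancel₀ two_ne_zero h

section Zeros

variable {a : ℝ} (ha : 0 < a) (f : Lp ℂ 2 (volume : Measure ℝ))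
  (heven : ∀ᵐ x : ℝ, f (-x) = f x) {c c' : ℂ}
  (hfc : ∀ᵐ x : ℝ, x ∈ Ioo (-a) a → f x = c)
  (hFc : ∀ᵐ x : ℝ, x ∈ Ioo (-a) a → (𝓕 f : Lp ℂ 2 (volume : Measure ℝ)) x = c')

include ha heven hfc hFc in
/-- **The value `∫_a^∞ 𝓕f(u)C_a(u,1+2j)du = −c·a^{2j+1}/(2j+1) + c'·∫_0^a D_a(u,1+2j)du`** for even `f`
with `f = c`, `𝓕f = c'` a.e. on `(−a,a)`: `C_a(u,1+2j) = −𝓕h_j(u)` (`h_j = x^{2j}𝟙_{|x|<a}`),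
`∫ 𝓕f·𝓕h_j = ∫ f·h_j = 2c·a^{2j+1}/(2j+1)` (multiplication formula), evenness and the split at `a`.
[cite: Burnol2001CRAS, Théorème 1.4 and Lemme 1.3 (TeX l.358–386); Burnol2004, proof of Thm. 6.10 (TeX l.2460–2462)] -/
private theorem sonineMellinExt_one_add_two_mul_eq (j : ℕ) :
    sonineMellinExt a a ((𝓕 f : Lp ℂ 2 (volume : Measure ℝ)) : ℝ → ℂ) (1 + 2 * j) =
      -(c * (a : ℂ) ^ (2 * j + 1) / (2 * j + 1)) +
        c' * ∫ u in Ioc 0 a, (oscMoment (2 * π * u) a (2 * j) + oscMoment (-(2 * π * u)) a (2 * j)) := by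
  set F : Lp ℂ 2 (volume : Measure ℝ) := 𝓕 f with hFdef
  have hff : (𝓕 F : Lp ℂ 2 (volume : Measure ℝ)) = f := fourier_fourier_eq_self_of_mem_evenL2 heven
  have hFeven : ∀ᵐ x : ℝ, (F : ℝ → ℂ) (-x) = (F : ℝ → ℂ) x := fourierL2_even heven
  have hh1 := integrable_hj a j
  have hh2 := memLp_hj a j
  set Hj : Lp ℂ 2 (volume : Measure ℝ) :=
    hh2.toLp (Set.indicator {x : ℝ | |x| < a} (fun x : ℝ ↦ (x : ℂ) ^ (2 * j))) with hHjdef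
  have hHjcoe : (Hj : ℝ → ℂ) =ᵐ[volume]
      Set.indicator {x : ℝ | |x| < a} (fun x : ℝ ↦ (x : ℂ) ^ (2 * j)) := hh2.coeFn_toLp
  set D : ℝ → ℂ := fun u ↦ oscMoment (2 * π * u) a (2 * j) + oscMoment (-(2 * π * u)) a (2 * j)
    with hD
  have hFHj : ((𝓕 Hj : Lp ℂ 2 (volume : Measure ℝ)) : ℝ → ℂ) =ᵐ[volume] D := by
    filter_upwards [Literature.Analysis.FunctionSpaces.fourier_toLp_ae_eq_fourierIntegral hh1 hh2]
      with u hu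
    rw [hu, fourierIntegral_hj ha j u]
  -- `φ = F · 𝓕Hj`
  set φ : ℝ → ℂ := fun u ↦ (F : ℝ → ℂ) u * ((𝓕 Hj : Lp ℂ 2 (volume : Measure ℝ)) : ℝ → ℂ) u with hφ
  have hφi : Integrable φ := (Lp.memLp F).integrable_mul (Lp.memLp _)
  have e1 : sonineMellinExt a a (F : ℝ → ℂ) (1 + 2 * j) = -∫ u in Ioi a, φ u := by
    rw [sonineMellinExt, ← integral_neg]
    refine integral_congr_ae ?_
    filter_upwards [ae_restrict_mem measurableSet_Ioi, ae_restrict_of_ae (s := Ioi a) hFHj]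
      with u hu hFu
    rw [hφ]
    simp only
    rw [hFu, hD, cosKernel_one_add_two_mul ha ((ha.trans hu).ne') j]
    ring
  have hDev : ∀ u, D (-u) = D u := fun u ↦ by
    rw [hD]; simp only
    rw [show (2 * π * -u : ℝ) = -(2 * π * u) by ring, neg_neg, add_comm]
  have hφev : ∀ᵐ u : ℝ, φ (-u) = φ u := by
    filter_upwards [hFeven, hFHj, ae_comp_neg (p := fun u ↦
      ((𝓕 Hj : Lp ℂ 2 (volume : Measure ℝ)) : ℝ → ℂ) u = D u) hFHj] with u h1 h2 h3
    rw [hφ]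
    simp only
    rw [h1, h2, h3, hDev]
  -- `∫_ℝ φ = 2(∫_{(0,a]} φ + ∫_{(a,∞)} φ)` and `∫_{(0,a]} φ = c'∫_{(0,a]} D`
  have e2 : ∫ u, φ u = 2 * (c' * ∫ u in Ioc 0 a, D u) + 2 * ∫ u in Ioi a, φ u := by
    rw [integral_eq_two_mul_integral_Ioi_zero hφi hφev]
    have hI : IntegrableOn φ (Ioi 0) := hφi.integrableOn
    rw [← Ioc_union_Ioi_eq_Ioi ha.le, setIntegral_union (Set.Ioc_disjoint_Ioi le_rfl) measurableSet_Ioi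
      (hI.mono_set Ioc_subset_Ioi_self) (hI.mono_set (Ioi_subset_Ioi ha.le)), mul_add]
    congr 2
    rw [← integral_const_mul]
    refine setIntegral_congr_ae measurableSet_Ioc ?_
    filter_upwards [hFc, hFHj, ae_ne a] with u hu hFu hua huI
    rw [hφ]
    simp only
    rw [hu ⟨by linarith [huI.1], lt_of_le_of_ne huI.2 hua⟩, hFu]
  -- `∫_ℝ φ = ∫ 𝓕F · Hj = ∫ f · h_j = 2c·a^{2j+1}/(2j+1)`
  have e3 : ∫ u, φ u = 2 * (c * (a : ℂ) ^ (2 * j + 1) / (2 * j + 1)) := by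
    rw [hφ]
    simp only
    rw [Literature.Analysis.Fourier.integral_mul_fourier_eq (V := ℝ) F Hj, hff,
      ← integral_indicator_const_mul_pow ha c j]
    refine integral_congr_ae ?_
    have hs : {x : ℝ | |x| < a} = Ioo (-a) a := by ext x; simp [abs_lt]
    filter_upwards [hHjcoe, hfc] with x hx hz
    rw [hx, hs]
    simp only [Set.indicator]
    split_ifs with hxa
    · rw [hz hxa]
    · rw [mul_zero]
  have h4 : ∫ u in Ioi a, φ u = c * (a : ℂ) ^ (2 * j + 1) / (2 * j + 1) - c' * ∫ u in Ioc 0 a, D u := by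
    have := e2.symm.trans e3
    linear_combination this / 2
  rw [hFdef] at e1
  rw [e1, h4]
  ring

end Zeros

/-! ### G. The explicit continuation `G_f(s) = c·a^{1−s}/(1−s) + c'·Ẽ_a(1−s) + ∫_a^∞ 𝓕f·C_a(·,1−s)` -/

section Explicit

variable {a : ℝ} (ha : 0 < a) (f : Lp ℂ 2 (volume : Measure ℝ))
  (heven : ∀ᵐ x : ℝ, f (-x) = f x) {c c' : ℂ}
  (hfc : ∀ᵐ x : ℝ, x ∈ Ioo (-a) a → f x = c)
  (hFc : ∀ᵐ x : ℝ, x ∈ Ioo (-a) a → (𝓕 f : Lp ℂ 2 (volume : Measure ℝ)) x = c')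
  {G : ℂ → ℂ}
  (hG : G = fun s ↦ c * (a : ℂ) ^ (1 - s) / (1 - s) +
    c' * ((ibpEntire (2 * π * a) a (1 - s - 2) - ibpEntire (-(2 * π * a)) a (1 - s - 2)) /
      (2 * π * I)) +
    sonineMellinExt a a ((𝓕 f : Lp ℂ 2 (volume : Measure ℝ)) : ℝ → ℂ) (1 - s))

/-- The entire part `s ↦ c'·Ẽ_a(1−s) + ∫_a^∞ 𝓕f·C_a(·,1−s)` is differentiable. [cite: Burnol2001CRAS, Lemme 1.2 and eq. (1.2) (TeX l.320–355)] -/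
private theorem differentiable_entirePart (ha : 0 < a) (f : Lp ℂ 2 (volume : Measure ℝ)) (c' : ℂ) :
    Differentiable ℂ (fun s : ℂ ↦
      c' * ((ibpEntire (2 * π * a) a (1 - s - 2) - ibpEntire (-(2 * π * a)) a (1 - s - 2)) /
        (2 * π * I)) +
      sonineMellinExt a a ((𝓕 f : Lp ℂ 2 (volume : Measure ℝ)) : ℝ → ℂ) (1 - s)) := by
  have hl : (2 * π * a : ℝ) ≠ 0 := by positivity
  have h0 : Differentiable ℂ (fun s : ℂ ↦ 1 - s - 2) := (differentiable_id.const_sub (1 : ℂ)).sub_const 2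
  have h1 := (differentiable_ibpEntire hl ha).comp h0
  have h2 := (differentiable_ibpEntire (neg_ne_zero.2 hl) ha).comp h0
  have h3 := (differentiable_sonineMellinExt ha ha (𝓕 f : Lp ℂ 2 (volume : Measure ℝ))).comp
    (differentiable_id.const_sub (1 : ℂ))
  exact (((h1.sub h2).div_const _).const_mul _).add h3

include ha hG in
/-- `G` is holomorphic off `s = 1`. [cite: Burnol2004, proof of Thm. 6.10 (TeX l.2436–2456)] -/
private theorem differentiableOn_explicit : DifferentiableOn ℂ G {s | s ≠ 1} := by
  have h1 : DifferentiableOn ℂ (fun s : ℂ ↦ c * (a : ℂ) ^ (1 - s) / (1 - s)) {s | s ≠ 1} := by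
    refine DifferentiableOn.div ?_ ?_ ?_
    · exact ((differentiable_id.const_sub (1 : ℂ)).const_cpow
        (Or.inl (ofReal_ne_zero.2 ha.ne'))).differentiableOn.const_mul c
    · exact (differentiable_id.const_sub (1 : ℂ)).differentiableOn
    · intro s hs; exact sub_ne_zero.2 (Ne.symm hs)
  have := h1.add (differentiable_entirePart ha f c').differentiableOn
  rw [hG]
  refine this.congr fun s _ ↦ ?_
  simp only [Pi.add_apply]
  ring

include ha heven hfc hFc hG in
/-- **`G` continues `f̂`**: holomorphic off `1` and equal to `f̂` on the strip `1/2 < Re s < 1`.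
[cite: Burnol2004, proof of Thm. 6.10 (TeX l.2430–2456); Burnol2004b, Prop. 2.2 (TeX l.460–469)] -/
theorem explicit_hasRightMellinContinuation : HasRightMellinContinuation f G := by
  refine ⟨differentiableOn_explicit ha f hG, fun s hs1 hs2 ↦ ?_⟩
  have hgm : MemLp (Set.indicator {x : ℝ | a < |x|} (f : ℝ → ℂ)) 2 volume :=
    (Lp.memLp f).indicator (isOpen_lt continuous_const continuous_abs).measurableSet
  have hg : ∀ᵐ x : ℝ, hgm.toLp _ x = Set.indicator {x : ℝ | a < |x|} (f : ℝ → ℂ) x := hgm.coeFn_toLp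
  have hw0 : 0 < (1 - s).re := by simp; linarith
  have hw : (1 - s).re < 1 / 2 := by simp; linarith
  rw [hG]
  dsimp only
  rw [rightMellin, mellin_eq_const_add_mellin_trunc ha f _ hg hfc hw0 hw,
    mellin_trunc_eq ha f _ hg heven hFc hw]
  ring

include ha hG in
/-- **At most a simple pole at `1`**: `(s−1)G(s) → −c`. [cite: Burnol2004b, Prop. 2.2 (TeX l.460–469); Burnol2004, Thm. 6.10 (TeX l.2417–2422)] -/
theorem explicit_tendsto_sub_one_mul : Tendsto (fun s ↦ (s - 1) * G s) (𝓝[≠] (1 : ℂ)) (𝓝 (-c)) := by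
  have hR := differentiable_entirePart ha f c'
  have hφ : ContinuousAt (fun s : ℂ ↦ -(c * (a : ℂ) ^ (1 - s)) + (s - 1) *
      (c' * ((ibpEntire (2 * π * a) a (1 - s - 2) - ibpEntire (-(2 * π * a)) a (1 - s - 2)) /
        (2 * π * I)) +
      sonineMellinExt a a ((𝓕 f : Lp ℂ 2 (volume : Measure ℝ)) : ℝ → ℂ) (1 - s))) (1 : ℂ) :=
    ((((differentiable_id.const_sub (1 : ℂ)).const_cpow
        (Or.inl (ofReal_ne_zero.2 ha.ne'))).const_mul c).neg.add
      ((differentiable_id.sub_const (1 : ℂ)).mul hR)).continuous.continuousAt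
  have hlim := hφ.tendsto
  simp only [sub_self, cpow_zero, mul_one, zero_mul, add_zero] at hlim
  refine (hlim.mono_left nhdsWithin_le_nhds).congr' ?_
  filter_upwards [self_mem_nhdsWithin] with s hs
  have hs' : (1 : ℂ) - s ≠ 0 := sub_ne_zero.2 (Ne.symm hs)
  have key : (s - 1) * (c * (a : ℂ) ^ (1 - s) / (1 - s)) = -(c * (a : ℂ) ^ (1 - s)) := by
    field_simp
    ring
  rw [hG]
  dsimp only
  linear_combination (-1 : ℂ) * key

include ha heven hfc hFc hG in
/-- **Trivial zeros**: `G(−2(n+1)) = 0`. [cite: Burnol2004b, Prop. 2.2 and §4 Note (TeX l.460–469, 614–623)] -/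
theorem explicit_trivial_zero (n : ℕ) : G (-2 * ((n : ℂ) + 1)) = 0 := by
  have hl : (2 * π * a : ℝ) ≠ 0 := by positivity
  rw [hG]
  simp only
  have hw : (1 : ℂ) - -2 * ((n : ℂ) + 1) = 1 + 2 * ((n + 1 : ℕ) : ℂ) := by push_cast; ring
  rw [hw]
  have hS : sonineMellinExt a a ((𝓕 f : Lp ℂ 2 (volume : Measure ℝ)) : ℝ → ℂ)
      (1 + 2 * ((n + 1 : ℕ) : ℂ)) = -(c * (a : ℂ) ^ (2 * (n + 1) + 1) / (2 * (n + 1) + 1)) +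
        c' * ∫ u in Ioc 0 a, (oscMoment (2 * π * u) a (2 * (n + 1)) +
          oscMoment (-(2 * π * u)) a (2 * (n + 1))) := by
    exact_mod_cast sonineMellinExt_one_add_two_mul_eq ha f heven hfc hFc (n + 1)
  have hEv : (ibpEntire (2 * π * a) a (1 + 2 * ((n + 1 : ℕ) : ℂ) - 2) -
      ibpEntire (-(2 * π * a)) a (1 + 2 * ((n + 1 : ℕ) : ℂ) - 2)) / (2 * π * I) =
      -∫ u in Ioc 0 a, (oscMoment (2 * π * u) a (2 * (n + 1)) +
          oscMoment (-(2 * π * u)) a (2 * (n + 1))) := by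
    rw [show (1 + 2 * ((n + 1 : ℕ) : ℂ) - 2) = ((2 * n + 1 : ℕ) : ℂ) by push_cast; ring,
      ibpEntire_sub_ibpEntire_neg_odd hl ha n, setIntegral_Ioc_fourier_hj ha n, neg_div]
  rw [hS, hEv]
  have e3 : (a : ℂ) ^ (1 + 2 * ((n + 1 : ℕ) : ℂ)) = (a : ℂ) ^ (2 * (n + 1) + 1) := by
    rw [show (1 + 2 * ((n + 1 : ℕ) : ℂ)) = ((2 * (n + 1) + 1 : ℕ) : ℂ) by push_cast; ring, cpow_natCast]
  rw [e3]
  push_cast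
  ring

include ha heven hfc hFc hG in
/-- The canonical continuation `rightMellinExt f` IS the explicit `G` off `s = 1` (uniqueness of the
continuation). [cite: Burnol2004b, Prop. 2.2 (TeX l.460–469)] -/
theorem rightMellinExt_eqOn_explicit : Set.EqOn (rightMellinExt f) G {s | s ≠ 1} :=
  (hasRightMellinContinuation_rightMellinExt
    ⟨G, explicit_hasRightMellinContinuation ha f heven hfc hFc hG⟩).eqOn
    (explicit_hasRightMellinContinuation ha f heven hfc hFc hG)

end Explicit

/-! ### H. Norm bookkeeping: the constants `c`, `c'` are controlled by `‖f‖` -/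

/-- `‖c‖·√(2a) ≤ ‖f‖` when `f = c` a.e. on `(−a,a)` ("`α(f)` … is a continuous linear form in `f`",
TeX l.2433–2434). [cite: Burnol2004, proof of Thm. 6.10 (TeX l.2432–2434)] -/
private theorem norm_const_mul_sqrt_le {f : Lp ℂ 2 (volume : Measure ℝ)} {a : ℝ} (ha : 0 < a) {c : ℂ}
    (hfc : ∀ᵐ x : ℝ, x ∈ Ioo (-a) a → f x = c) : ‖c‖ * Real.sqrt (2 * a) ≤ ‖f‖ := by
  have h1 : eLpNorm ((Ioo (-a) a).indicator fun _ ↦ c) 2 volume ≤ eLpNorm f 2 volume := by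
    calc eLpNorm ((Ioo (-a) a).indicator fun _ ↦ c) 2 volume
        = eLpNorm ((Ioo (-a) a).indicator (f : ℝ → ℂ)) 2 volume := by
          refine eLpNorm_congr_ae ?_
          filter_upwards [hfc] with x hx
          simp only [Set.indicator]
          split_ifs with h
          · exact (hx h).symm
          · rfl
      _ ≤ eLpNorm f 2 volume := eLpNorm_indicator_le _
  rw [eLpNorm_indicator_const measurableSet_Ioo (by norm_num) (by norm_num), Real.volume_Ioo,
    show a - -a = 2 * a by ring] at h1
  have h2 := ENNReal.toReal_mono (Lp.memLp f).eLpNorm_ne_top h1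
  rw [ENNReal.toReal_mul, toReal_enorm, ← ENNReal.toReal_rpow, ENNReal.toReal_ofReal (by positivity),
    ENNReal.toReal_ofNat, Real.sqrt_eq_rpow] at *
  rw [Lp.norm_def]
  convert h2 using 2

/-! ### I. Prop. 2.2 (iv) and (iii): the value at `0` and the residue at `1` are bounded by `‖f‖` -/

/-- **Prop. 2.2 (iv)**: `‖G_f(0)‖ ≤ C·‖f‖` on `L_a` ("the evaluations … are continuous"; `G_f(0)` is
`½·Res_{s=0} M(f)`). [cite: Burnol2004b, Prop. 2.2 (arXiv:math/0203120v7 p. 5, TeX l.460–469); Burnol2004, Thm. 6.10 (TeX l.2462–2468)] -/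
theorem exists_bound_rightMellinExt_zero_of_sonineL {a : ℝ} (ha : 0 < a) :
    ∃ C : ℝ, ∀ f ∈ sonineL a, ‖rightMellinExt f 0‖ ≤ C * ‖f‖ := by
  obtain ⟨C₁, hC₁0, hC₁⟩ := exists_bound_sonineMellinExt ha ha 1
  set E1 : ℝ := ‖(ibpEntire (2 * π * a) a (1 - 2) - ibpEntire (-(2 * π * a)) a (1 - 2)) /
    (2 * π * I)‖ with hE1
  have hsq : 0 < Real.sqrt (2 * a) := Real.sqrt_pos.2 (by positivity)
  refine ⟨(a + E1) / Real.sqrt (2 * a) + C₁, fun f hf ↦ ?_⟩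
  obtain ⟨heven, ⟨c, hc⟩, ⟨c', hc'⟩⟩ := hf
  have hfc := ae_const_Ioo_of_even heven hc
  have hFc := ae_const_Ioo_of_even (fourierL2_even heven) hc'
  set G : ℂ → ℂ := fun s ↦ c * (a : ℂ) ^ (1 - s) / (1 - s) +
    c' * ((ibpEntire (2 * π * a) a (1 - s - 2) - ibpEntire (-(2 * π * a)) a (1 - s - 2)) /
      (2 * π * I)) +
    sonineMellinExt a a ((𝓕 f : Lp ℂ 2 (volume : Measure ℝ)) : ℝ → ℂ) (1 - s) with hG
  have h0 : (0 : ℂ) ∈ {s : ℂ | s ≠ 1} := by simp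
  rw [rightMellinExt_eqOn_explicit ha f heven hfc hFc hG h0, hG]
  simp only [sub_zero, cpow_one, div_one]
  have hc1 : ‖c‖ ≤ ‖f‖ / Real.sqrt (2 * a) := by
    rw [le_div_iff₀ hsq]; exact norm_const_mul_sqrt_le ha hfc
  have hc2 : ‖c'‖ ≤ ‖f‖ / Real.sqrt (2 * a) := by
    rw [le_div_iff₀ hsq, ← MeasureTheory.Lp.norm_fourier_eq f]; exact norm_const_mul_sqrt_le ha hFc
  have hS : ‖sonineMellinExt a a ((𝓕 f : Lp ℂ 2 (volume : Measure ℝ)) : ℝ → ℂ) 1‖ ≤ C₁ * ‖f‖ := by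
    rw [← MeasureTheory.Lp.norm_fourier_eq f]; exact hC₁ _ 1 (by simp)
  have ha' : ‖(a : ℂ)‖ = a := by rw [Complex.norm_real, Real.norm_eq_abs, abs_of_pos ha]
  calc ‖c * (a : ℂ) + c' * ((ibpEntire (2 * π * a) a (1 - 2) -
        ibpEntire (-(2 * π * a)) a (1 - 2)) / (2 * π * I)) +
        sonineMellinExt a a ((𝓕 f : Lp ℂ 2 (volume : Measure ℝ)) : ℝ → ℂ) 1‖
      ≤ ‖c * (a : ℂ)‖ + ‖c' * ((ibpEntire (2 * π * a) a (1 - 2) -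
        ibpEntire (-(2 * π * a)) a (1 - 2)) / (2 * π * I))‖ +
        ‖sonineMellinExt a a ((𝓕 f : Lp ℂ 2 (volume : Measure ℝ)) : ℝ → ℂ) 1‖ := norm_add₃_le
    _ ≤ ‖f‖ / Real.sqrt (2 * a) * a + ‖f‖ / Real.sqrt (2 * a) * E1 + C₁ * ‖f‖ := by
        rw [norm_mul, norm_mul, ha', ← hE1]
        gcongr
    _ = ((a + E1) / Real.sqrt (2 * a) + C₁) * ‖f‖ := by ring

/-- **Prop. 2.2 (iii)**: the residue of `G_f` at `s = 1` is `−c` (`c` = the constant value of `f` on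
`(0,a)`), hence `‖Res_{s=1} G_f‖ ≤ ‖f‖/√(2a)` on `L_a` ("`f ↦ Res_{s=1}(M(f))` [is a] continuous linear
form"). [cite: Burnol2004b, Prop. 2.2 (arXiv:math/0203120v7 p. 5, TeX l.460–469); Burnol2004, Thm. 6.10 (TeX l.2436–2441)] -/
theorem exists_bound_residueAt_rightMellinExt_one_of_sonineL {a : ℝ} (ha : 0 < a) :
    ∃ C : ℝ, ∀ f ∈ sonineL a,
      ‖Literature.Analysis.Complex.residueAt (rightMellinExt f) 1‖ ≤ C * ‖f‖ := by
  have hsq : 0 < Real.sqrt (2 * a) := Real.sqrt_pos.2 (by positivity)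
  refine ⟨1 / Real.sqrt (2 * a), fun f hf ↦ ?_⟩
  obtain ⟨heven, ⟨c, hc⟩, ⟨c', hc'⟩⟩ := hf
  have hfc := ae_const_Ioo_of_even heven hc
  have hFc := ae_const_Ioo_of_even (fourierL2_even heven) hc'
  set G : ℂ → ℂ := fun s ↦ c * (a : ℂ) ^ (1 - s) / (1 - s) +
    c' * ((ibpEntire (2 * π * a) a (1 - s - 2) - ibpEntire (-(2 * π * a)) a (1 - s - 2)) /
      (2 * π * I)) +
    sonineMellinExt a a ((𝓕 f : Lp ℂ 2 (volume : Measure ℝ)) : ℝ → ℂ) (1 - s) with hG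
  have heq := rightMellinExt_eqOn_explicit ha f heven hfc hFc hG
  have hGd := differentiableOn_explicit ha f hG
  -- replace the ε-continuation by `G` near `1`
  have hev : ∀ᶠ z in 𝓝[≠] (1 : ℂ), G z = rightMellinExt f z :=
    eventually_nhdsWithin_of_forall fun z hz ↦ (heq hz).symm
  have hGdiff : ∀ᶠ z in 𝓝[≠] (1 : ℂ), DifferentiableAt ℂ G z := by
    filter_upwards [self_mem_nhdsWithin] with z hz
    exact hGd.differentiableAt (isOpen_ne.mem_nhds hz)
  rw [Literature.Analysis.Complex.residueAt_congr hGdiff hev]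
  -- principal part of `G` at `1`: `c·a^{1−s}/(1−s) = −c(s−1)⁻¹ − c·K(s)` with `a^{1−s} = 1 + (s−1)K(s)`
  have hF : AnalyticAt ℂ (fun s : ℂ ↦ (a : ℂ) ^ (1 - s)) 1 :=
    ((differentiable_id.const_sub (1 : ℂ)).const_cpow (Or.inl (ofReal_ne_zero.2 ha.ne'))).analyticAt 1
  obtain ⟨b, K, hK, hTaylor⟩ := Literature.Analysis.Complex.exists_taylor_truncation hF 1
  have hb0 : b 0 = 1 := by
    have := hTaylor.self_of_nhds
    simpa using this.symm
  have hR : AnalyticAt ℂ (fun s : ℂ ↦ -c * K s +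
      (c' * ((ibpEntire (2 * π * a) a (1 - s - 2) - ibpEntire (-(2 * π * a)) a (1 - s - 2)) /
        (2 * π * I)) +
      sonineMellinExt a a ((𝓕 f : Lp ℂ 2 (volume : Measure ℝ)) : ℝ → ℂ) (1 - s))) 1 :=
    (analyticAt_const.mul hK).add ((differentiable_entirePart ha f c').analyticAt 1)
  have hpp : ∀ᶠ z in 𝓝[≠] (1 : ℂ), G z =
      (∑ k ∈ Finset.range 1, (fun _ ↦ -c) k * (z - 1) ^ (-(k + 1 : ℤ))) +
        (-c * K z + (c' * ((ibpEntire (2 * π * a) a (1 - z - 2) -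
          ibpEntire (-(2 * π * a)) a (1 - z - 2)) / (2 * π * I)) +
          sonineMellinExt a a ((𝓕 f : Lp ℂ 2 (volume : Measure ℝ)) : ℝ → ℂ) (1 - z))) := by
    have hT' : ∀ᶠ z in 𝓝[≠] (1 : ℂ), (a : ℂ) ^ (1 - z) = 1 + (z - 1) * K z := by
      filter_upwards [mem_nhdsWithin_of_mem_nhds hTaylor] with z hz
      rw [hz, Finset.sum_range_one, hb0]
      ring
    filter_upwards [hT', self_mem_nhdsWithin] with z hz hz1
    have hz1' : (1 : ℂ) - z ≠ 0 := sub_ne_zero.2 (Ne.symm hz1)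
    have hz1'' : z - 1 ≠ 0 := sub_ne_zero.2 hz1
    rw [hG]
    simp only [Finset.sum_range_one, Nat.cast_zero, zero_add, zpow_neg, zpow_one]
    rw [hz]
    field_simp
    ring
  rw [Literature.Analysis.Complex.residueAt_eq_of_principalPart hR hpp]
  simp only [zero_lt_one, if_true, norm_neg]
  rw [one_div, inv_mul_eq_div, le_div_iff₀ hsq]
  exact norm_const_mul_sqrt_le ha hfc

/-! ### J. The test function `h_w = |x|^{w−1}𝟙_{|x|<a}` (private copies of the plumbing of
`SonineMellinFunctionalEquation.lean`) -/

/-- `h_w` is even. [folklore] -/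
private theorem hw_neg (a : ℝ) (w : ℂ) (x : ℝ) :
    (Set.indicator {x : ℝ | |x| < a} (fun x : ℝ ↦ ((|x| : ℝ) : ℂ) ^ (w - 1))) (-x) =
      (Set.indicator {x : ℝ | |x| < a} (fun x : ℝ ↦ ((|x| : ℝ) : ℂ) ^ (w - 1))) x := by
  simp [Set.indicator, abs_neg]

/-- On `x > 0`, `h_w(x) = x^{w−1}𝟙_{(0,a)}(x)`. [folklore] -/
private theorem hw_eq_indicator_of_pos (a : ℝ) (w : ℂ) {x : ℝ} (hx : 0 < x) :
    (Set.indicator {x : ℝ | |x| < a} (fun x : ℝ ↦ ((|x| : ℝ) : ℂ) ^ (w - 1))) x =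
      Set.indicator (Ioo 0 a) (fun x : ℝ ↦ (x : ℂ) ^ (w - 1)) x := by
  simp [Set.indicator, abs_of_pos hx, hx]

/-- `h_w` is measurable. [folklore] -/
private theorem measurable_hw (a : ℝ) (w : ℂ) :
    Measurable (Set.indicator {x : ℝ | |x| < a} (fun x : ℝ ↦ ((|x| : ℝ) : ℂ) ^ (w - 1))) := by
  refine Measurable.indicator ?_ (isOpen_lt continuous_abs continuous_const).measurableSet
  exact (Complex.measurable_ofReal.comp continuous_abs.measurable).pow_const _

/-- `h_w` is integrable on `(0,∞)` for `Re w > 0`. [folklore] -/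
private theorem integrableOn_hw_Ioi {a : ℝ} (ha : 0 < a) {w : ℂ} (hw : 0 < w.re) :
    IntegrableOn (Set.indicator {x : ℝ | |x| < a} (fun x : ℝ ↦ ((|x| : ℝ) : ℂ) ^ (w - 1))) (Ioi 0) := by
  have h1 : IntegrableOn (fun x : ℝ ↦ (x : ℂ) ^ (w - 1)) (Ioo 0 a) :=
    (intervalIntegral.integrableOn_Ioo_cpow_iff ha).mpr (by simp; linarith)
  have h2 : IntegrableOn (Set.indicator (Ioo 0 a) (fun x : ℝ ↦ (x : ℂ) ^ (w - 1))) (Ioi 0) :=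
    (h1.integrable_indicator measurableSet_Ioo).integrableOn
  exact h2.congr_fun (fun x hx ↦ (hw_eq_indicator_of_pos a w hx).symm) measurableSet_Ioi

/-- `h_w ∈ L¹(ℝ)` for `Re w > 0`. [folklore] -/
private theorem integrable_hw {a : ℝ} (ha : 0 < a) {w : ℂ} (hw : 0 < w.re) :
    Integrable (Set.indicator {x : ℝ | |x| < a} (fun x : ℝ ↦ ((|x| : ℝ) : ℂ) ^ (w - 1))) :=
  integrable_of_even (hw_neg a w) (integrableOn_hw_Ioi ha hw)

/-- `h_w ∈ L²(ℝ)` for `Re w > 1/2`. [folklore] -/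
private theorem memLp_hw {a : ℝ} (ha : 0 < a) {w : ℂ} (hw : 1 / 2 < w.re) :
    MemLp (Set.indicator {x : ℝ | |x| < a} (fun x : ℝ ↦ ((|x| : ℝ) : ℂ) ^ (w - 1))) 2 volume := by
  rw [memLp_two_iff_integrable_sq_norm (measurable_hw a w).aestronglyMeasurable]
  set N : ℝ → ℝ := fun x ↦ ‖(Set.indicator {x : ℝ | |x| < a}
    (fun x : ℝ ↦ ((|x| : ℝ) : ℂ) ^ (w - 1))) x‖ ^ 2 with hN
  have hNeven : ∀ x, N (-x) = N x := by intro x; simp [hN, hw_neg]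
  have h1 : IntegrableOn (fun x : ℝ ↦ x ^ (2 * (w.re - 1))) (Ioo 0 a) := by
    rw [← intervalIntegrable_iff_integrableOn_Ioo_of_le ha.le]
    exact intervalIntegral.intervalIntegrable_rpow' (by linarith)
  have h2 : IntegrableOn N (Ioi 0) := by
    have h3 : IntegrableOn (Set.indicator (Ioo 0 a) (fun x : ℝ ↦ x ^ (2 * (w.re - 1)))) (Ioi 0) :=
      (h1.integrable_indicator measurableSet_Ioo).integrableOn
    refine h3.congr_fun (fun x hx ↦ ?_) measurableSet_Ioi
    rw [hN]; simp only
    rw [hw_eq_indicator_of_pos a w hx]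
    by_cases hxa : x < a
    · have hxm : x ∈ Ioo 0 a := ⟨hx, hxa⟩
      rw [Set.indicator_of_mem hxm, Set.indicator_of_mem hxm,
        norm_cpow_eq_rpow_re_of_pos hx, ← Real.rpow_natCast, ← Real.rpow_mul hx.le]
      congr 1; simp; ring
    · have hxm : x ∉ Ioo 0 a := fun h ↦ hxa h.2
      rw [Set.indicator_of_notMem hxm, Set.indicator_of_notMem hxm]
      simp
  exact integrable_of_even hNeven h2

/-! ### K. The sine moment in closed form on the strip `1/2 < Re w < 1`:
`Ẽ_a(w) + ∫_0^a D_a(u,w)du = γ₊(w)·a^{1−w}/(1−w)` (the Mellin transform of `𝓕₊𝟙_{(0,a)} = sin(2πat)/(πt)`) -/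

/-- `(e^{2πiat} − e^{−2πiat})t^{w−2}/(2πi) = a·sincKernel(at)·t^{w−1}` for `t > 0` (`sincKernel(x) =
sin(2πx)/(πx)`). [folklore] -/
private theorem exp_sub_exp_mul_cpow_eq {a t : ℝ} (ha : 0 < a) (ht : 0 < t) (w : ℂ) :
    (cexp (I * (2 * π * a : ℝ) * t) * (t : ℂ) ^ (w - 2) -
        cexp (I * (-(2 * π * a) : ℝ) * t) * (t : ℂ) ^ (w - 2)) / (2 * π * I) =
      (t : ℂ) ^ (w - 1) * ((a : ℂ) * Literature.Analysis.SpecialFunctions.sincKernel (a * t)) := by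
  have hat : a * t ≠ 0 := (mul_pos ha ht).ne'
  have ht' : (t : ℂ) ≠ 0 := ofReal_ne_zero.2 ht.ne'
  have hπ : (π : ℂ) ≠ 0 := ofReal_ne_zero.2 Real.pi_pos.ne'
  have haC : (a : ℂ) ≠ 0 := ofReal_ne_zero.2 ha.ne'
  rw [Literature.Analysis.SpecialFunctions.sincKernel_eq hat]
  set x : ℂ := 2 * π * (a * t) with hx
  have key : cexp (x * I) - cexp (-x * I) = 2 * Complex.sin x * I := by
    rw [Complex.exp_mul_I, Complex.exp_mul_I, Complex.cos_neg, Complex.sin_neg]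
    ring
  have e1 : cexp (I * (2 * π * a : ℝ) * t) = cexp (x * I) := by
    congr 1; push_cast; rw [hx]; ring
  have e2 : cexp (I * (-(2 * π * a) : ℝ) * t) = cexp (-x * I) := by
    congr 1; push_cast; rw [hx]; ring
  have hcp : (t : ℂ) ^ (w - 1) = (t : ℂ) ^ (w - 2) * t := by
    rw [show w - 1 = (w - 2) + 1 by ring, cpow_add _ _ ht', cpow_one]
  rw [e1, e2, ← sub_mul, key, hcp]
  push_cast
  rw [← hx]
  field_simp

/-- **`Ẽ_a(w) + ∫_0^a D_a(u,w)du = γ₊(w)·a^{1−w}/(1−w)` for `1/2 < Re w < 1`.** Both pieces are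
integrals of `(sin(2πat)/(πt))·t^{w−1}` — over `(a,∞)` (the sine moment, absolutely convergent for
`Re w < 1`) and over `(0,a]` (the multiplication formula against `𝟙_{(−a,a)}`: `∫_{−a}^a 𝓕h_w =
∫ 𝓕𝟙_{(−a,a)}·h_w`, `𝓕h_w = D_a(·,w)` for `Re w > 1/2`) — and `∫_0^∞ (sin(2πat)/(πt))t^{w−1}dt =
a^{1−w}·(−2(2π)^{−w}cos(πw/2)Γ(w−1)) = γ₊(w)a^{1−w}/(1−w)` (the tree's `hasMellin_sincKernel`). This is the
"`χ₊(s)u^{s−1} + O(1)` on `(0,λ)`" bookkeeping of the printed proof, i.e. eq. (1.1) for `𝟙_{(0,a)}`.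
[cite: Burnol2004, proof of Thm. 6.10 (TeX l.2448–2456); Burnol2001CRAS, eq. (1.1) and Lemme 1.3 (TeX l.279–281, 358–367)] -/
private theorem sineMoment_add_setIntegral_D_eq {a : ℝ} (ha : 0 < a) {w : ℂ} (hw : 1 / 2 < w.re)
    (hw1 : w.re < 1) :
    (ibpEntire (2 * π * a) a (w - 2) - ibpEntire (-(2 * π * a)) a (w - 2)) / (2 * π * I) +
        ∫ u in Ioc 0 a, (2 * ∫ t in Ioc 0 a, ((Real.cos (2 * π * u * t) : ℝ) : ℂ) * (t : ℂ) ^ (w - 1)) =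
      gammaPlus w * (a : ℂ) ^ (1 - w) / (1 - w) := by
  have hw0 : 0 < w.re := by linarith
  have hl : (2 * π * a : ℝ) ≠ 0 := by positivity
  set φ : ℝ → ℂ := fun t ↦ (t : ℂ) ^ (w - 1) *
    ((a : ℂ) * Literature.Analysis.SpecialFunctions.sincKernel (a * t)) with hφ
  -- (a) the sine moment as `∫_a^∞ φ`
  have hz : (w - 2).re < -1 := by simp; linarith
  have hi1 := integrableOn_cexp_mul_cpow (2 * π * a) ha hz
  have hi2 := integrableOn_cexp_mul_cpow (-(2 * π * a)) ha hz
  have hA : (ibpEntire (2 * π * a) a (w - 2) - ibpEntire (-(2 * π * a)) a (w - 2)) / (2 * π * I) =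
      ∫ t in Ioi a, φ t := by
    rw [ibpEntire_eq_integral hl ha hz, ibpEntire_eq_integral (neg_ne_zero.2 hl) ha hz,
      ← integral_sub hi1 hi2, ← integral_div]
    refine setIntegral_congr_fun measurableSet_Ioi fun t (ht : a < t) ↦ ?_
    rw [hφ]
    exact exp_sub_exp_mul_cpow_eq ha (ha.trans ht) w
  -- (b) `∫_0^a D_a(u,w) du = ∫_{(0,a]} φ` by the multiplication formula against `𝟙_{(−a,a)}`
  have hB : ∫ u in Ioc 0 a, (2 * ∫ t in Ioc 0 a, ((Real.cos (2 * π * u * t) : ℝ) : ℂ) * (t : ℂ) ^ (w - 1)) =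
      ∫ t in Ioc 0 a, φ t := by
    -- the class `Hw` of `h_w`
    have hh1 := integrable_hw ha hw0
    have hh2 := memLp_hw ha hw
    set Hw : Lp ℂ 2 (volume : Measure ℝ) :=
      hh2.toLp (Set.indicator {x : ℝ | |x| < a} (fun x : ℝ ↦ ((|x| : ℝ) : ℂ) ^ (w - 1))) with hHwdef
    have hHwcoe : (Hw : ℝ → ℂ) =ᵐ[volume]
        Set.indicator {x : ℝ | |x| < a} (fun x : ℝ ↦ ((|x| : ℝ) : ℂ) ^ (w - 1)) := hh2.coeFn_toLp
    set D : ℝ → ℂ := fun u ↦ 2 * ∫ t in Ioc 0 a, ((Real.cos (2 * π * u * t) : ℝ) : ℂ) * (t : ℂ) ^ (w - 1)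
      with hD
    have hFHw : ((𝓕 Hw : Lp ℂ 2 (volume : Measure ℝ)) : ℝ → ℂ) =ᵐ[volume] D := by
      filter_upwards [Literature.Analysis.FunctionSpaces.fourier_toLp_ae_eq_fourierIntegral hh1 hh2]
        with u hu
      rw [hu, fourierIntegral_hw ha hw0 u]
    -- the indicator class `H`
    set h0 : ℝ → ℂ := Set.indicator {x : ℝ | |x| < a} (fun x : ℝ ↦ (x : ℂ) ^ (2 * 0)) with hh0
    have hs : {x : ℝ | |x| < a} = Ioo (-a) a := by ext x; simp [abs_lt]
    have hh0' : h0 = Set.indicator (Ioo (-a) a) (fun _ ↦ (1 : ℂ)) := by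
      rw [hh0, hs]
      ext x
      simp [Set.indicator]
    have hvol : volume (Ioo (-a) a) ≠ ∞ := by simp [Real.volume_Ioo]
    have hh01 : Integrable h0 := by
      rw [hh0', integrable_indicator_iff measurableSet_Ioo]
      exact integrableOn_const hvol
    have hh02 : MemLp h0 2 volume := by
      rw [hh0']
      exact memLp_indicator_const 2 measurableSet_Ioo (1 : ℂ) (Or.inr hvol)
    set H : Lp ℂ 2 (volume : Measure ℝ) := hh02.toLp h0 with hHdef
    have hHcoe : (H : ℝ → ℂ) =ᵐ[volume] h0 := hh02.coeFn_toLp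
    have hFH : ((𝓕 H : Lp ℂ 2 (volume : Measure ℝ)) : ℝ → ℂ) =ᵐ[volume]
        fun t ↦ oscMoment (2 * π * t) a 0 + oscMoment (-(2 * π * t)) a 0 := by
      filter_upwards [Literature.Analysis.FunctionSpaces.fourier_toLp_ae_eq_fourierIntegral hh01 hh02]
        with t ht
      rw [ht, hh0, fourierIntegral_hj ha 0 t]
    have hP := Literature.Analysis.Fourier.integral_mul_fourier_eq (V := ℝ) H Hw
    -- left side `= 2∫_{(0,a]} D`
    have hDev : ∀ u, D (-u) = D u := fun u ↦ by
      rw [hD]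
      simp only
      congr 1
      refine setIntegral_congr_fun measurableSet_Ioc fun t _ ↦ ?_
      rw [show 2 * π * -u * t = -(2 * π * u * t) by ring, Real.cos_neg]
    have hL : ∫ x, (H : ℝ → ℂ) x * ((𝓕 Hw : Lp ℂ 2 (volume : Measure ℝ)) : ℝ → ℂ) x =
        2 * ∫ u in Ioc 0 a, D u := by
      have e1 : ∫ x, (H : ℝ → ℂ) x * ((𝓕 Hw : Lp ℂ 2 (volume : Measure ℝ)) : ℝ → ℂ) x =
          ∫ x, (Ioo (-a) a).indicator D x := by
        refine integral_congr_ae ?_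
        filter_upwards [hHcoe, hFHw] with x h1 h2
        rw [h1, h2, hh0']
        simp only [Set.indicator]
        split_ifs <;> simp
      have hint : Integrable ((Ioo (-a) a).indicator D) := by
        have : Integrable (fun x ↦ (H : ℝ → ℂ) x *
            ((𝓕 Hw : Lp ℂ 2 (volume : Measure ℝ)) : ℝ → ℂ) x) :=
          (Lp.memLp H).integrable_mul (Lp.memLp _)
        refine this.congr ?_
        filter_upwards [hHcoe, hFHw] with x h1 h2
        rw [h1, h2, hh0']
        simp only [Set.indicator]
        split_ifs <;> simp
      have hev : ∀ᵐ x : ℝ, (Ioo (-a) a).indicator D (-x) = (Ioo (-a) a).indicator D x := by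
        refine Eventually.of_forall fun x ↦ ?_
        simp only [Set.indicator, mem_Ioo, hDev]
        split_ifs with h1 h2 h2
        · rfl
        · exact absurd ⟨by linarith [h1.2], by linarith [h1.1]⟩ h2
        · exact absurd ⟨by linarith [h2.2], by linarith [h2.1]⟩ h1
        · rfl
      rw [e1, integral_eq_two_mul_integral_Ioi_zero hint hev, setIntegral_indicator measurableSet_Ioo,
        show Ioi (0 : ℝ) ∩ Ioo (-a) a = Ioo 0 a by
          ext x; constructor
          · rintro ⟨h1, h2⟩; exact ⟨h1, h2.2⟩
          · rintro ⟨h1, h2⟩; exact ⟨h1, by linarith, h2⟩,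
        integral_Ioc_eq_integral_Ioo]
    -- right side `= 2∫_{(0,a]} φ`
    have hR : ∫ x, ((𝓕 H : Lp ℂ 2 (volume : Measure ℝ)) : ℝ → ℂ) x * (Hw : ℝ → ℂ) x =
        2 * ∫ t in Ioc 0 a, φ t := by
      set ψ : ℝ → ℂ := fun t ↦ (oscMoment (2 * π * t) a 0 + oscMoment (-(2 * π * t)) a 0) *
        Set.indicator {x : ℝ | |x| < a} (fun x : ℝ ↦ ((|x| : ℝ) : ℂ) ^ (w - 1)) t with hψ
      have e1 : ∫ x, ((𝓕 H : Lp ℂ 2 (volume : Measure ℝ)) : ℝ → ℂ) x * (Hw : ℝ → ℂ) x = ∫ t, ψ t := by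
        refine integral_congr_ae ?_
        filter_upwards [hFH, hHwcoe] with t h1 h2
        rw [h1, h2]
      have hint : Integrable ψ := by
        have : Integrable (fun x ↦ ((𝓕 H : Lp ℂ 2 (volume : Measure ℝ)) : ℝ → ℂ) x * (Hw : ℝ → ℂ) x) :=
          (Lp.memLp _).integrable_mul (Lp.memLp Hw)
        refine this.congr ?_
        filter_upwards [hFH, hHwcoe] with t h1 h2
        rw [h1, h2]
      have hev : ∀ᵐ t : ℝ, ψ (-t) = ψ t := by
        refine Eventually.of_forall fun t ↦ ?_
        rw [hψ]
        simp only [hw_neg]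
        rw [show (2 * π * -t : ℝ) = -(2 * π * t) by ring, neg_neg, add_comm]
      rw [e1, integral_eq_two_mul_integral_Ioi_zero hint hev]
      congr 1
      have e2 : ∫ t in Ioi 0, ψ t = ∫ t in Ioi 0, (Ioo 0 a).indicator φ t := by
        refine setIntegral_congr_fun measurableSet_Ioi fun t (ht : 0 < t) ↦ ?_
        rw [hψ]
        simp only
        rw [hw_eq_indicator_of_pos a w ht]
        by_cases hta : t < a
        · rw [Set.indicator_of_mem (show t ∈ Ioo 0 a from ⟨ht, hta⟩),
            Set.indicator_of_mem (show t ∈ Ioo 0 a from ⟨ht, hta⟩), oscMoment_zero_add_mul_cpow ht w, hφ,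
            exp_sub_exp_mul_cpow_eq ha ht w]
        · rw [Set.indicator_of_notMem (fun h : t ∈ Ioo 0 a ↦ hta h.2),
            Set.indicator_of_notMem (fun h : t ∈ Ioo 0 a ↦ hta h.2), mul_zero]
      rw [e2, setIntegral_indicator measurableSet_Ioo,
        show Ioi (0 : ℝ) ∩ Ioo 0 a = Ioo 0 a from inter_eq_right.2 Ioo_subset_Ioi_self,
        integral_Ioc_eq_integral_Ioo]
    have h := hP
    rw [hL, hR] at h
    have := mul_left_cancel₀ (two_ne_zero (α := ℂ)) h
    rw [hD] at this
    exact this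
  -- (c) the Mellin transform of `a·sincKernel(a·)`
  have hM := Literature.Analysis.SpecialFunctions.hasMellin_sincKernel hw0 hw1
  have hconv : MellinConvergent
      (fun t : ℝ ↦ (a : ℂ) * Literature.Analysis.SpecialFunctions.sincKernel (a * t)) w :=
    ((MellinConvergent.comp_mul_left ha).2 hM.1).const_smul (a : ℂ)
  have hval : mellin (fun t : ℝ ↦ (a : ℂ) * Literature.Analysis.SpecialFunctions.sincKernel (a * t)) w =
      (a : ℂ) * ((a : ℂ) ^ (-w) *
        -(2 * (2 * π : ℂ) ^ (-w) * Complex.cos (π * w / 2) * Complex.Gamma (w - 1))) := by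
    have h1 := mellin_comp_mul_left Literature.Analysis.SpecialFunctions.sincKernel w ha
    rw [hM.2, smul_eq_mul] at h1
    have e : (fun t : ℝ ↦ (a : ℂ) * Literature.Analysis.SpecialFunctions.sincKernel (a * t)) =
        fun t ↦ (a : ℂ) • (fun u : ℝ ↦ Literature.Analysis.SpecialFunctions.sincKernel (a * u)) t := by
      funext t; simp [smul_eq_mul]
    rw [e, mellin_const_smul, h1, smul_eq_mul]
  have hsplit : (∫ t in Ioi a, φ t) + ∫ t in Ioc 0 a, φ t = ∫ t in Ioi 0, φ t := by
    have hI : IntegrableOn φ (Ioi 0) := by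
      refine hconv.congr_fun (fun t _ ↦ ?_) measurableSet_Ioi
      simp only [hφ, smul_eq_mul]
    rw [add_comm, ← setIntegral_union (Set.Ioc_disjoint_Ioi le_rfl) measurableSet_Ioi
      (hI.mono_set Ioc_subset_Ioi_self) (hI.mono_set (Ioi_subset_Ioi ha.le)), Ioc_union_Ioi_eq_Ioi ha.le]
  rw [hA, hB, hsplit]
  have hmel : ∫ t in Ioi 0, φ t =
      mellin (fun t : ℝ ↦ (a : ℂ) * Literature.Analysis.SpecialFunctions.sincKernel (a * t)) w := by
    rw [mellin]
    refine setIntegral_congr_fun measurableSet_Ioi fun t _ ↦ ?_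
    simp only [hφ, smul_eq_mul]
  rw [hmel, hval, gammaPlus]
  -- `Γ(w) = (w−1)Γ(w−1)`, `a·a^{−w} = a^{1−w}`
  have hw1' : w - 1 ≠ 0 := by
    intro h; have := congrArg Complex.re h; simp at this; linarith
  have hw1'' : (1 : ℂ) - w ≠ 0 := by
    intro h; apply hw1'; linear_combination -h
  have haC : (a : ℂ) ≠ 0 := ofReal_ne_zero.2 ha.ne'
  rw [show Complex.Gamma w = (w - 1) * Complex.Gamma (w - 1) by
      rw [← Complex.Gamma_add_one _ hw1']; ring_nf,
    show (a : ℂ) ^ (1 - w) = (a : ℂ) * (a : ℂ) ^ (-w) by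
      rw [sub_eq_add_neg, cpow_add _ _ haC, cpow_one]]
  field_simp
  ring

/-! ### L. The `D`-term on `L_a`: `∫_a^∞ 𝓕f·D_a(·,w) = c·a^w/w − c'·∫_0^a D_a(u,w)du` (`Re w > 1/2`) -/

section DTerm

variable {a : ℝ} (ha : 0 < a) (f : Lp ℂ 2 (volume : Measure ℝ))
  (heven : ∀ᵐ x : ℝ, f (-x) = f x) {c c' : ℂ}
  (hfc : ∀ᵐ x : ℝ, x ∈ Ioo (-a) a → f x = c)
  (hFc : ∀ᵐ x : ℝ, x ∈ Ioo (-a) a → (𝓕 f : Lp ℂ 2 (volume : Measure ℝ)) x = c')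

include ha heven hfc hFc in
/-- **The `D`-term on `L_a`.** For `Re w > 1/2`: `∫_a^∞ 𝓕f(u)D_a(u,w)du = c·a^w/w − c'·∫_0^a D_a(u,w)du`
(`D_a(·,w) = 𝓕h_w`, `h_w = |x|^{w−1}𝟙_{|x|<a}`; multiplication formula `∫ 𝓕f·𝓕h_w = ∫ f·h_w = 2c·a^w/w`,
evenness and the split at `a`). The `K_a` case (`c = c' = 0`) is g2's `integral_fourier_mul_D_eq_zero`.
[cite: Burnol2001CRAS, §1, proof of eq. (1.3) (TeX l.331–335); Burnol2004, proof of Thm. 6.10 (TeX l.2448–2456)] -/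
private theorem setIntegral_Ioi_fourier_mul_D_eq {w : ℂ} (hw : 1 / 2 < w.re) :
    ∫ u in Ioi a, ((𝓕 f : Lp ℂ 2 (volume : Measure ℝ)) : ℝ → ℂ) u *
        (2 * ∫ t in Ioc 0 a, ((Real.cos (2 * π * u * t) : ℝ) : ℂ) * (t : ℂ) ^ (w - 1)) =
      c * (a : ℂ) ^ w / w -
        c' * ∫ u in Ioc 0 a, (2 * ∫ t in Ioc 0 a, ((Real.cos (2 * π * u * t) : ℝ) : ℂ) * (t : ℂ) ^ (w - 1)) := by
  have hw0 : 0 < w.re := by linarith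
  have hwne : w ≠ 0 := fun h ↦ by simp [h] at hw0
  set F : Lp ℂ 2 (volume : Measure ℝ) := 𝓕 f with hFdef
  have hff : (𝓕 F : Lp ℂ 2 (volume : Measure ℝ)) = f := fourier_fourier_eq_self_of_mem_evenL2 heven
  have hFeven : ∀ᵐ x : ℝ, (F : ℝ → ℂ) (-x) = (F : ℝ → ℂ) x := fourierL2_even heven
  have hh1 := integrable_hw ha hw0
  have hh2 := memLp_hw ha hw
  set Hw : Lp ℂ 2 (volume : Measure ℝ) :=
    hh2.toLp (Set.indicator {x : ℝ | |x| < a} (fun x : ℝ ↦ ((|x| : ℝ) : ℂ) ^ (w - 1))) with hHwdef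
  have hHwcoe : (Hw : ℝ → ℂ) =ᵐ[volume]
      Set.indicator {x : ℝ | |x| < a} (fun x : ℝ ↦ ((|x| : ℝ) : ℂ) ^ (w - 1)) := hh2.coeFn_toLp
  set D : ℝ → ℂ := fun u ↦ 2 * ∫ t in Ioc 0 a, ((Real.cos (2 * π * u * t) : ℝ) : ℂ) * (t : ℂ) ^ (w - 1)
    with hD
  have hFHw : ((𝓕 Hw : Lp ℂ 2 (volume : Measure ℝ)) : ℝ → ℂ) =ᵐ[volume] D := by
    filter_upwards [Literature.Analysis.FunctionSpaces.fourier_toLp_ae_eq_fourierIntegral hh1 hh2]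
      with u hu
    rw [hu, fourierIntegral_hw ha hw0 u]
  have hDev : ∀ u, D (-u) = D u := fun u ↦ by
    rw [hD]
    simp only
    congr 1
    refine setIntegral_congr_fun measurableSet_Ioc fun t _ ↦ ?_
    rw [show 2 * π * -u * t = -(2 * π * u * t) by ring, Real.cos_neg]
  set φ : ℝ → ℂ := fun u ↦ (F : ℝ → ℂ) u * ((𝓕 Hw : Lp ℂ 2 (volume : Measure ℝ)) : ℝ → ℂ) u with hφ
  have hφi : Integrable φ := (Lp.memLp F).integrable_mul (Lp.memLp _)
  have hφev : ∀ᵐ u : ℝ, φ (-u) = φ u := by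
    filter_upwards [hFeven, hFHw, ae_comp_neg (p := fun u ↦
      ((𝓕 Hw : Lp ℂ 2 (volume : Measure ℝ)) : ℝ → ℂ) u = D u) hFHw] with u h1 h2 h3
    rw [hφ]
    simp only
    rw [h1, h2, h3, hDev]
  -- `∫_ℝ φ = 2(c'∫_{(0,a]} D + ∫_{(a,∞)} F·D)`
  have e2 : ∫ u, φ u = 2 * (c' * ∫ u in Ioc 0 a, D u) +
      2 * ∫ u in Ioi a, (F : ℝ → ℂ) u * D u := by
    rw [integral_eq_two_mul_integral_Ioi_zero hφi hφev]
    have hI : IntegrableOn φ (Ioi 0) := hφi.integrableOn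
    rw [← Ioc_union_Ioi_eq_Ioi ha.le, setIntegral_union (Set.Ioc_disjoint_Ioi le_rfl) measurableSet_Ioi
      (hI.mono_set Ioc_subset_Ioi_self) (hI.mono_set (Ioi_subset_Ioi ha.le)), mul_add]
    congr 2
    · rw [← integral_const_mul]
      refine setIntegral_congr_ae measurableSet_Ioc ?_
      filter_upwards [hFc, hFHw, ae_ne a] with u hu hFu hua huI
      rw [hφ]
      simp only
      rw [hu ⟨by linarith [huI.1], lt_of_le_of_ne huI.2 hua⟩, hFu]
    · refine setIntegral_congr_ae measurableSet_Ioi ?_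
      filter_upwards [hFHw] with u hFu _
      rw [hφ]
      simp only
      rw [hFu]
  -- `∫_ℝ φ = ∫ 𝓕F·h_w = ∫ f·h_w = 2c·a^w/w`
  have e3 : ∫ u, φ u = 2 * (c * (a : ℂ) ^ w / w) := by
    rw [hφ]
    simp only
    rw [Literature.Analysis.Fourier.integral_mul_fourier_eq (V := ℝ) F Hw, hff]
    -- `∫ f·h_w`: the integrand is even and equals `c·x^{w−1}` on `(0,a)`
    set ψ : ℝ → ℂ := fun x ↦ (f : ℝ → ℂ) x * (Hw : ℝ → ℂ) x with hψ
    have hψi : Integrable ψ := (Lp.memLp f).integrable_mul (Lp.memLp Hw)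
    have hψev : ∀ᵐ x : ℝ, ψ (-x) = ψ x := by
      filter_upwards [heven, hHwcoe, ae_comp_neg (p := fun x ↦ (Hw : ℝ → ℂ) x =
        Set.indicator {x : ℝ | |x| < a} (fun x : ℝ ↦ ((|x| : ℝ) : ℂ) ^ (w - 1)) x) hHwcoe]
        with x h1 h2 h3
      rw [hψ]
      simp only
      rw [h1, h2, h3, hw_neg]
    have hw1 : -1 < (w - 1).re := by simp; linarith
    have hIoc : IntegrableOn (fun t : ℝ ↦ (t : ℂ) ^ (w - 1)) (Ioc 0 a) :=
      (intervalIntegral.intervalIntegrable_cpow' (a := 0) (b := a) hw1).1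
    change ∫ x, ψ x = _
    rw [integral_eq_two_mul_integral_Ioi_zero hψi hψev]
    congr 1
    have e4 : ∫ x in Ioi 0, ψ x = ∫ x in Ioi 0, (Ioo 0 a).indicator (fun x : ℝ ↦ c * (x : ℂ) ^ (w - 1)) x := by
      refine setIntegral_congr_ae measurableSet_Ioi ?_
      filter_upwards [hHwcoe, hfc] with x hx hfx hx0
      have hx0' : (0 : ℝ) < x := hx0
      rw [hψ]
      simp only
      rw [hx, hw_eq_indicator_of_pos a w hx0']
      by_cases hxa : x < a
      · rw [Set.indicator_of_mem (show x ∈ Ioo 0 a from ⟨hx0', hxa⟩),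
          Set.indicator_of_mem (show x ∈ Ioo 0 a from ⟨hx0', hxa⟩), hfx ⟨by linarith, hxa⟩]
      · rw [Set.indicator_of_notMem (fun h : x ∈ Ioo 0 a ↦ hxa h.2),
          Set.indicator_of_notMem (fun h : x ∈ Ioo 0 a ↦ hxa h.2), mul_zero]
    rw [e4, setIntegral_indicator measurableSet_Ioo,
      show Ioi (0 : ℝ) ∩ Ioo 0 a = Ioo 0 a from inter_eq_right.2 Ioo_subset_Ioi_self, integral_const_mul,
      ← integral_Ioc_eq_integral_Ioo, ← intervalIntegral.integral_of_le ha.le, integral_cpow (Or.inl hw1),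
      sub_add_cancel, Complex.ofReal_zero, Complex.zero_cpow hwne, sub_zero, mul_div_assoc]
  have h4 : ∫ u in Ioi a, (F : ℝ → ℂ) u * D u = c * (a : ℂ) ^ w / w - c' * ∫ u in Ioc 0 a, D u := by
    have := e2.symm.trans e3
    linear_combination this / 2
  rw [hFdef, hD] at h4
  exact h4

end DTerm

/-! ### M. Eq. (1.3) integrated against `𝓕f` on `(a,∞)`:
`∫_a^∞ 𝓕f·C_a(·,w) = γ₊(w)·∫_a^∞ 𝓕f(u)u^{−w}du − ∫_a^∞ 𝓕f·D_a(·,w)` (`Re w > 1/2`) -/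

/-- For `F ∈ L²(ℝ)` and `Re w > 1/2`:
`∫_a^∞ F(u)C_a(u,w)du = γ₊(w)∫_a^∞ F(u)u^{−w}du − ∫_a^∞ F(u)D_a(u,w)du`, from the pointwise closed form
`C_a(u,w) = γ₊(w)u^{−w} − D_a(u,w)` (eq. (1.3), `cosKernel_eq_closedForm`), with both pieces integrable
(`u^{−w} ∈ L²(a,∞)`; `D_a(·,w) = 𝓕h_w ∈ L²`). [cite: Burnol2001CRAS, eq. (1.3) (TeX l.352–355)] -/
private theorem sonineMellinExt_eq_gammaPlus_mul_sub {a : ℝ} (ha : 0 < a)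
    (F : Lp ℂ 2 (volume : Measure ℝ)) {w : ℂ} (hw : 1 / 2 < w.re) :
    sonineMellinExt a a (F : ℝ → ℂ) w =
      gammaPlus w * (∫ u in Ioi a, (F : ℝ → ℂ) u * (u : ℂ) ^ (-w)) -
        ∫ u in Ioi a, (F : ℝ → ℂ) u *
          (2 * ∫ t in Ioc 0 a, ((Real.cos (2 * π * u * t) : ℝ) : ℂ) * (t : ℂ) ^ (w - 1)) := by
  have hw0 : 0 < w.re := by linarith
  -- integrability of `F·u^{−w}` on `(a,∞)`
  have hI1 : IntegrableOn (fun u : ℝ ↦ (F : ℝ → ℂ) u * (u : ℂ) ^ (-w)) (Ioi a) := by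
    have h1 : Integrable (fun x ↦ (F : ℝ → ℂ) x *
        Set.indicator {x : ℝ | a < |x|} (fun x : ℝ ↦ ((|x| : ℝ) : ℂ) ^ ((1 - w) - 1)) x) :=
      (Lp.memLp F).integrable_mul (memLp_gw ha (by simp; linarith : (1 - w).re < 1 / 2))
    refine (h1.integrableOn (s := Ioi a)).congr_fun_ae ?_
    filter_upwards [ae_restrict_mem measurableSet_Ioi] with u hu
    have hu' : (0 : ℝ) < u := ha.trans hu
    rw [gw_eq_indicator_of_pos a _ hu', Set.indicator_of_mem (show u ∈ Ioi a from hu),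
      show (1 : ℂ) - w - 1 = -w by ring]
  -- integrability of `F·D_a(·,w)` on `(a,∞)` (`D_a(·,w) = 𝓕h_w ∈ L²`)
  have hh1 := integrable_hw ha hw0
  have hh2 := memLp_hw ha hw
  set Hw : Lp ℂ 2 (volume : Measure ℝ) :=
    hh2.toLp (Set.indicator {x : ℝ | |x| < a} (fun x : ℝ ↦ ((|x| : ℝ) : ℂ) ^ (w - 1))) with hHwdef
  have hFHw : ((𝓕 Hw : Lp ℂ 2 (volume : Measure ℝ)) : ℝ → ℂ) =ᵐ[volume]
      fun u ↦ 2 * ∫ t in Ioc 0 a, ((Real.cos (2 * π * u * t) : ℝ) : ℂ) * (t : ℂ) ^ (w - 1) := by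
    filter_upwards [Literature.Analysis.FunctionSpaces.fourier_toLp_ae_eq_fourierIntegral hh1 hh2]
      with u hu
    rw [hu, fourierIntegral_hw ha hw0 u]
  have hI2 : IntegrableOn (fun u : ℝ ↦ (F : ℝ → ℂ) u *
      (2 * ∫ t in Ioc 0 a, ((Real.cos (2 * π * u * t) : ℝ) : ℂ) * (t : ℂ) ^ (w - 1))) (Ioi a) := by
    have h1 : Integrable (fun x ↦ (F : ℝ → ℂ) x * ((𝓕 Hw : Lp ℂ 2 (volume : Measure ℝ)) : ℝ → ℂ) x) :=
      (Lp.memLp F).integrable_mul (Lp.memLp _)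
    refine (h1.integrableOn (s := Ioi a)).congr_fun_ae ?_
    filter_upwards [ae_restrict_of_ae (s := Ioi a) hFHw] with u hu
    rw [hu]
  rw [sonineMellinExt, ← integral_const_mul, ← integral_sub (hI1.const_mul _) hI2]
  refine setIntegral_congr_fun measurableSet_Ioi fun u (hu : a < u) ↦ ?_
  rw [cosKernel_eq_closedForm ha (ha.trans hu) hw0]
  ring

/-! ### N. The functional equation -/

/-- `∫_a^∞ F(u)u^{−w}du` is the Mellin transform of the truncation at `1 − w`. [folklore] -/
private theorem setIntegral_Ioi_mul_cpow_eq_mellin_trunc {a : ℝ} (ha : 0 < a)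
    (F g : Lp ℂ 2 (volume : Measure ℝ))
    (hg : ∀ᵐ x : ℝ, g x = Set.indicator {x : ℝ | a < |x|} (F : ℝ → ℂ) x) (w : ℂ) :
    ∫ u in Ioi a, (F : ℝ → ℂ) u * (u : ℂ) ^ (-w) = mellin (g : ℝ → ℂ) (1 - w) := by
  rw [mellin]
  have e : ∫ t : ℝ in Ioi 0, ((t : ℝ) : ℂ) ^ (1 - w - 1) • (g : ℝ → ℂ) t =
      ∫ t : ℝ in Ioi 0, (Ioi a).indicator (fun u : ℝ ↦ (F : ℝ → ℂ) u * (u : ℂ) ^ (-w)) t := by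
    refine setIntegral_congr_ae measurableSet_Ioi ?_
    filter_upwards [hg] with t ht h0
    have h0' : (0 : ℝ) < t := h0
    rw [ht, smul_eq_mul, show (1 : ℂ) - w - 1 = -w by ring]
    by_cases hta : a < t
    · have hm : t ∈ {x : ℝ | a < |x|} := by simp [abs_of_pos h0', hta]
      rw [Set.indicator_of_mem hm, Set.indicator_of_mem (show t ∈ Ioi a from hta)]
      ring
    · have hm : t ∉ {x : ℝ | a < |x|} := by simp [abs_of_pos h0', not_lt.1 hta]
      rw [Set.indicator_of_notMem hm, Set.indicator_of_notMem (show t ∉ Ioi a from hta), mul_zero]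
  rw [e, setIntegral_indicator measurableSet_Ioi, inter_eq_right.2 (Ioi_subset_Ioi ha.le)]

/-- `Γ_ℝ(1−s)·γ₊(s) = Γ_ℝ(s)` on `0 < Re s < 1` (private copy of the lemma of
`SonineMellinFunctionalEquation.lean`; Mathlib's `Gammaℝ_div_Gammaℝ_one_sub`). [folklore] -/
private theorem Gammaℝ_one_sub_mul_gammaPlus {s : ℂ} (hs : 0 < s.re) (hs1 : s.re < 1) :
    Gammaℝ (1 - s) * gammaPlus s = Gammaℝ s := by
  have hs' : ∀ n : ℕ, s ≠ -(2 * n + 1) := by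
    intro n hn
    have := congrArg Complex.re hn
    simp at this
    linarith
  have hG1 : Gammaℝ (1 - s) ≠ 0 := Gammaℝ_ne_zero_of_re_pos (by simp; linarith)
  have h := Gammaℝ_div_Gammaℝ_one_sub hs'
  rw [div_eq_iff hG1] at h
  rw [h, gammaPlus, Gammaℂ_def]; ring

/-- `Γ_ℝ` is differentiable away from its poles (where Mathlib's `Γ_ℝ` takes the junk value `0`). [folklore] -/
private theorem differentiableAt_Gammaℝ {z : ℂ} (hz : Gammaℝ z ≠ 0) : DifferentiableAt ℂ Gammaℝ z := by
  have h : ∀ m : ℕ, z / 2 ≠ -m := by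
    intro m hm
    apply hz
    rw [Gammaℝ_eq_zero_iff]
    exact ⟨m, by linear_combination 2 * hm⟩
  have h1 : DifferentiableAt ℂ (fun s : ℂ ↦ (π : ℂ) ^ (-s / 2)) z :=
    ((differentiableAt_id.neg.div_const 2).const_cpow (Or.inl (ofReal_ne_zero.2 Real.pi_pos.ne')))
  have h2 : DifferentiableAt ℂ (fun s : ℂ ↦ Complex.Gamma (s / 2)) z :=
    (Complex.differentiableAt_Gamma _ h).comp z (differentiableAt_id.div_const 2)
  have e : Gammaℝ = fun s ↦ (π : ℂ) ^ (-s / 2) * Complex.Gamma (s / 2) := funext Gammaℝ_def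
  rw [e]
  exact h1.mul h2

section FE

variable {a : ℝ} (ha : 0 < a) (f : Lp ℂ 2 (volume : Measure ℝ))
  (heven : ∀ᵐ x : ℝ, f (-x) = f x) {c c' : ℂ}
  (hfc : ∀ᵐ x : ℝ, x ∈ Ioo (-a) a → f x = c)
  (hFc : ∀ᵐ x : ℝ, x ∈ Ioo (-a) a → (𝓕 f : Lp ℂ 2 (volume : Measure ℝ)) x = c')
  {Gf GF : ℂ → ℂ}
  (hGf : Gf = fun s ↦ c * (a : ℂ) ^ (1 - s) / (1 - s) +
    c' * ((ibpEntire (2 * π * a) a (1 - s - 2) - ibpEntire (-(2 * π * a)) a (1 - s - 2)) /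
      (2 * π * I)) +
    sonineMellinExt a a ((𝓕 f : Lp ℂ 2 (volume : Measure ℝ)) : ℝ → ℂ) (1 - s))
  (hGF : GF = fun s ↦ c' * (a : ℂ) ^ (1 - s) / (1 - s) +
    c * ((ibpEntire (2 * π * a) a (1 - s - 2) - ibpEntire (-(2 * π * a)) a (1 - s - 2)) /
      (2 * π * I)) +
    sonineMellinExt a a ((𝓕 (𝓕 f : Lp ℂ 2 (volume : Measure ℝ)) : Lp ℂ 2 (volume : Measure ℝ)) :
      ℝ → ℂ) (1 - s))

include ha heven hfc hFc hGf hGF in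
/-- **The functional equation on the strip `1/2 < Re s < 1`**: `Γ_ℝ(s)G_{𝓕f}(s) = Γ_ℝ(1−s)G_f(1−s)`,
assembled from eq. (1.3) integrated against `𝓕f` (§M), the `D`-term (§L), the continuation formula for the
truncation of `𝓕f` (§E with the roles of `f`, `𝓕f` exchanged — `𝓕𝓕f = f`), the sine-moment identity (§K)
and `Γ_ℝ(1−s)γ₊(s) = Γ_ℝ(s)`: "In this critical strip we have the functional equation
`f̂(s) = χ₊(s)(𝓕₊f)^(1−s)`" (TeX l.2456–2459).
[cite: Burnol2004, proof of Thm. 6.10 (TeX l.2456–2462); Burnol2004b, Prop. 2.2 (TeX l.460–469); Burnol2001CRAS, eq. (1.1) (TeX l.279–281)] -/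
private theorem fe_on_strip {s : ℂ} (hs0 : 1 / 2 < s.re) (hs1 : s.re < 1) :
    Gammaℝ s * GF s = Gammaℝ (1 - s) * Gf (1 - s) := by
  set F : Lp ℂ 2 (volume : Measure ℝ) := 𝓕 f with hFdef
  have hff : (𝓕 F : Lp ℂ 2 (volume : Measure ℝ)) = f := fourier_fourier_eq_self_of_mem_evenL2 heven
  have hFeven : ∀ᵐ x : ℝ, (F : ℝ → ℂ) (-x) = (F : ℝ → ℂ) x := fourierL2_even heven
  have hFFc : ∀ᵐ x : ℝ, x ∈ Ioo (-a) a → ((𝓕 F : Lp ℂ 2 (volume : Measure ℝ)) : ℝ → ℂ) x = c := by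
    rw [hff]; exact hfc
  -- the truncation of `F`
  have hgm : MemLp (Set.indicator {x : ℝ | a < |x|} (F : ℝ → ℂ)) 2 volume :=
    (Lp.memLp F).indicator (isOpen_lt continuous_const continuous_abs).measurableSet
  have hg : ∀ᵐ x : ℝ, hgm.toLp _ x = Set.indicator {x : ℝ | a < |x|} (F : ℝ → ℂ) x := hgm.coeFn_toLp
  have hw : (1 - s).re < 1 / 2 := by simp; linarith
  -- the five identities
  have hS := sonineMellinExt_eq_gammaPlus_mul_sub ha F hs0
  have hM := setIntegral_Ioi_mul_cpow_eq_mellin_trunc ha F _ hg s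
  have hMe := mellin_trunc_eq ha F _ hg hFeven hFFc hw
  have hDt := setIntegral_Ioi_fourier_mul_D_eq ha f heven hfc hFc hs0
  have hK := sineMoment_add_setIntegral_D_eq ha hs0 hs1
  have hΓ := Gammaℝ_one_sub_mul_gammaPlus (by linarith : 0 < s.re) hs1
  rw [hGf, hGF]
  simp only [sub_sub_cancel]
  rw [hS, hM, hMe, hDt, eq_sub_of_add_eq hK, ← hΓ]
  ring


include ha heven hfc hFc hGf hGF in
/-- **The functional equation off the poles**: `Γ_ℝ(s)G_{𝓕f}(s) = Γ_ℝ(1−s)G_f(1−s)` whenever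
`Γ_ℝ(s) ≠ 0` and `Γ_ℝ(1−s) ≠ 0` — analytic continuation from the strip (both sides holomorphic on the
connected open set `{Γ_ℝ ≠ 0} ∩ {Γ_ℝ(1−·) ≠ 0} = ℂ ∖ (−2ℕ ∪ (1+2ℕ))`, complement of a countable set).
[cite: Burnol2004, proof of Thm. 6.10 (TeX l.2456–2462); Burnol2004b, Prop. 2.2 (TeX l.460–469)] -/
private theorem fe_off_poles {s : ℂ} (hs0 : Gammaℝ s ≠ 0) (hs1 : Gammaℝ (1 - s) ≠ 0) :
    Gammaℝ s * GF s = Gammaℝ (1 - s) * Gf (1 - s) := by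
  set W : Set ℂ := {z | Gammaℝ z ≠ 0 ∧ Gammaℝ (1 - z) ≠ 0} with hW
  -- `W` is open
  have hcont : Continuous fun z : ℂ ↦ (Gammaℝ z)⁻¹ := differentiable_Gammaℝ_inv.continuous
  have hWopen : IsOpen W := by
    have e : W = {z | (Gammaℝ z)⁻¹ ≠ 0} ∩ {z | (Gammaℝ (1 - z))⁻¹ ≠ 0} := by
      ext z; simp [hW, inv_eq_zero]
    rw [e]
    exact (isOpen_ne_fun hcont continuous_const).inter
      (isOpen_ne_fun (hcont.comp (continuous_const.sub continuous_id)) continuous_const)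
  -- `W` is the complement of a countable set, hence preconnected
  have hWconn : IsPreconnected W := by
    have hcount : (Wᶜ).Countable := by
      have hsub : Wᶜ ⊆ Set.range (fun n : ℕ ↦ -(2 * (n : ℂ))) ∪ Set.range (fun n : ℕ ↦ 1 + 2 * (n : ℂ)) := by
        intro z hz
        simp only [hW, mem_compl_iff, mem_setOf_eq, not_and_or, not_not] at hz
        rcases hz with hz | hz
        · obtain ⟨n, hn⟩ := Gammaℝ_eq_zero_iff.1 hz
          exact Or.inl ⟨n, hn.symm⟩
        · obtain ⟨n, hn⟩ := Gammaℝ_eq_zero_iff.1 hz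
          exact Or.inr ⟨n, by linear_combination hn⟩
      exact ((Set.countable_range _).union (Set.countable_range _)).mono hsub
    have := hcount.isPathConnected_compl_of_one_lt_rank (E := ℂ) (by simp)
    rw [compl_compl] at this
    exact this.isConnected.isPreconnected
  -- both sides are holomorphic on `W`
  have hd1 : DifferentiableOn ℂ (fun z ↦ Gammaℝ z * GF z) W := by
    intro z hz
    have hz1 : z ≠ 1 := by
      intro h; apply hz.2; rw [h, sub_self]; exact Gammaℝ_eq_zero_iff.2 ⟨0, by simp⟩
    have hGFd := (differentiableOn_explicit ha (𝓕 f : Lp ℂ 2 (volume : Measure ℝ)) hGF).differentiableAt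
      (isOpen_ne.mem_nhds hz1)
    exact ((differentiableAt_Gammaℝ hz.1).mul hGFd).differentiableWithinAt
  have hd2 : DifferentiableOn ℂ (fun z ↦ Gammaℝ (1 - z) * Gf (1 - z)) W := by
    intro z hz
    have hz0 : 1 - z ≠ 1 := by
      intro h
      have : z = 0 := by linear_combination -h
      apply hz.1; rw [this]; exact Gammaℝ_eq_zero_iff.2 ⟨0, by simp⟩
    have hsub : DifferentiableAt ℂ (fun z : ℂ ↦ 1 - z) z := differentiableAt_id.const_sub 1
    have hGfd := ((differentiableOn_explicit ha f hGf).differentiableAt (isOpen_ne.mem_nhds hz0)).comp z hsub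
    have hΓd := (differentiableAt_Gammaℝ hz.2).comp z hsub
    exact (hΓd.mul hGfd).differentiableWithinAt
  have ha1 := hd1.analyticOnNhd hWopen
  have ha2 := hd2.analyticOnNhd hWopen
  -- base point `3/4` and agreement on the strip
  have hre : ((3 / 4 : ℂ)).re = 3 / 4 := by norm_num
  have h34 : (3 / 4 : ℂ) ∈ W := by
    refine ⟨Gammaℝ_ne_zero_of_re_pos (by rw [hre]; norm_num), Gammaℝ_ne_zero_of_re_pos ?_⟩
    simp only [sub_re, one_re, hre]; norm_num
  have hev : (fun z ↦ Gammaℝ z * GF z) =ᶠ[𝓝 (3 / 4 : ℂ)] fun z ↦ Gammaℝ (1 - z) * Gf (1 - z) := by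
    have hV : IsOpen {z : ℂ | 1 / 2 < z.re ∧ z.re < 1} :=
      (isOpen_lt continuous_const Complex.continuous_re).inter (isOpen_lt Complex.continuous_re continuous_const)
    have hm : (3 / 4 : ℂ) ∈ {z : ℂ | 1 / 2 < z.re ∧ z.re < 1} := by
      simp only [mem_setOf_eq, hre]; norm_num
    filter_upwards [hV.mem_nhds hm] with z hz
    exact fe_on_strip ha f heven hfc hFc hGf hGF hz.1 hz.2
  exact ha1.eqOn_of_preconnected_of_eventuallyEq ha2 hWconn h34 hev ⟨hs0, hs1⟩

end FE

/-! ### O. Prop. 2.2 (v): the functional equation for the canonical continuations on `L_a` -/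

/-- **Prop. 2.2 (v) — the functional equation `M(𝓕₊f)(s) = M(f)(1−s)` on `L_a`** in the pole-free form of
the named fact: for `f ∈ L_a` and `s ∉ −2ℕ`, `s ∉ 1 + 2ℕ`,
`Γ_ℝ(s)·G_{𝓕f}(s) = Γ_ℝ(1−s)·G_f(1−s)` for the canonical continuations `G = rightMellinExt`.
[cite: Burnol2004b, Prop. 2.2 (arXiv:math/0203120v7 p. 5, TeX l.460–469); Burnol2004, Thm. 6.10 (TeX l.2417–2462)] -/
theorem rightMellinExt_functionalEquation_of_mem_sonineL {a : ℝ} (ha : 0 < a)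
    {f : Lp ℂ 2 (volume : Measure ℝ)} (hf : f ∈ sonineL a) (s : ℂ)
    (hs0 : ∀ n : ℕ, s ≠ -2 * (n : ℂ)) (hs1 : ∀ n : ℕ, s ≠ 1 + 2 * (n : ℂ)) :
    Gammaℝ s * rightMellinExt (𝓕 f : Lp ℂ 2 (volume : Measure ℝ)) s =
      Gammaℝ (1 - s) * rightMellinExt f (1 - s) := by
  obtain ⟨heven, ⟨c, hc⟩, ⟨c', hc'⟩⟩ := hf
  have hfc := ae_const_Ioo_of_even heven hc
  have hFc := ae_const_Ioo_of_even (fourierL2_even heven) hc'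
  set F : Lp ℂ 2 (volume : Measure ℝ) := 𝓕 f with hFdef
  have hff : (𝓕 F : Lp ℂ 2 (volume : Measure ℝ)) = f := fourier_fourier_eq_self_of_mem_evenL2 heven
  have hFeven : ∀ᵐ x : ℝ, (F : ℝ → ℂ) (-x) = (F : ℝ → ℂ) x := fourierL2_even heven
  have hFFc : ∀ᵐ x : ℝ, x ∈ Ioo (-a) a → ((𝓕 F : Lp ℂ 2 (volume : Measure ℝ)) : ℝ → ℂ) x = c := by
    rw [hff]; exact hfc
  set Gf : ℂ → ℂ := fun s ↦ c * (a : ℂ) ^ (1 - s) / (1 - s) +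
    c' * ((ibpEntire (2 * π * a) a (1 - s - 2) - ibpEntire (-(2 * π * a)) a (1 - s - 2)) /
      (2 * π * I)) +
    sonineMellinExt a a (F : ℝ → ℂ) (1 - s) with hGf
  set GF : ℂ → ℂ := fun s ↦ c' * (a : ℂ) ^ (1 - s) / (1 - s) +
    c * ((ibpEntire (2 * π * a) a (1 - s - 2) - ibpEntire (-(2 * π * a)) a (1 - s - 2)) /
      (2 * π * I)) +
    sonineMellinExt a a ((𝓕 F : Lp ℂ 2 (volume : Measure ℝ)) : ℝ → ℂ) (1 - s) with hGF
  have hΓ0 : Gammaℝ s ≠ 0 := by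
    intro h
    obtain ⟨n, hn⟩ := Gammaℝ_eq_zero_iff.1 h
    exact hs0 n (by rw [hn]; ring)
  have hΓ1 : Gammaℝ (1 - s) ≠ 0 := by
    intro h
    obtain ⟨n, hn⟩ := Gammaℝ_eq_zero_iff.1 h
    exact hs1 n (by linear_combination -hn)
  have hs_ne1 : s ∈ {z : ℂ | z ≠ 1} := by
    show s ≠ 1
    intro h; apply hΓ1; rw [h, sub_self]; exact Gammaℝ_eq_zero_iff.2 ⟨0, by simp⟩
  have hs_ne0 : (1 - s) ∈ {z : ℂ | z ≠ 1} := by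
    show 1 - s ≠ 1
    intro h
    have : s = 0 := by linear_combination -h
    apply hΓ0; rw [this]; exact Gammaℝ_eq_zero_iff.2 ⟨0, by simp⟩
  rw [rightMellinExt_eqOn_explicit ha F hFeven hFc hFFc hGF hs_ne1,
    rightMellinExt_eqOn_explicit ha f heven hfc hFc hGf hs_ne0]
  exact fe_off_poles ha f heven hfc hFc hGf hGF hΓ0 hΓ1

/-! ### P. Prop. 2.2 (ii): the evaluations `f ↦ M(f)^{(k)}(w)` are bounded on `L_a` -/

/-- `Γ_ℝ(w) ≠ 0` for `w ∉ {0, −2, −4, …}`. [folklore] -/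
private theorem Gammaℝ_ne_zero_of_ne {w : ℂ} (hw0 : w ≠ 0)
    (hwn : ∀ n : ℕ, w ≠ -2 * ((n : ℂ) + 1)) : Gammaℝ w ≠ 0 := by
  intro h
  obtain ⟨n, hn⟩ := Gammaℝ_eq_zero_iff.1 h
  cases n with
  | zero => exact hw0 (by simpa using hn)
  | succ m => exact hwn m (by rw [hn]; push_cast; ring)

/-- **Prop. 2.2 (ii) — continuity of the evaluations** `f ↦ M(f)^{(k)}(w) = (Γ_ℝ·G_f)^{(k)}(w)` on `L_a`
for `w ≠ 1`, `w ∉ {0, −2, −4, …}` and `k ∈ ℕ`: there is `C = C(a,w,k)` with `|M(f)^{(k)}(w)| ≤ C‖f‖`.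
Proof (as printed: "the evaluations … are continuous linear forms", via the explicit continuation):
near `w` the completed transform is `Γ_ℝ(z)·G_f(z)` with the explicit `G_f` of section G, which is bounded
on a fixed closed disc around `w` by `(sup|Γ_ℝ|)·(B₁|c| + B₂|c'| + C_S‖𝓕f‖) ≤ K‖f‖` (`|c|,|c'| ≤ ‖f‖/√(2a)`,
Plancherel, and the `L²` bound `exists_bound_sonineMellinExt` for the entire tail); Cauchy's inequality
then bounds the `k`-th derivative at `w`.
[cite: Burnol2004b, Prop. 2.2 (arXiv:math/0203120v7 p. 5, TeX l.460–476); Burnol2004, Thm. 6.10] -/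
theorem exists_bound_burnolEval_of_sonineL {a : ℝ} (ha : 0 < a) {w : ℂ} (hw0 : w ≠ 0) (hw1 : w ≠ 1)
    (hwn : ∀ n : ℕ, w ≠ -2 * ((n : ℂ) + 1)) (k : ℕ) :
    ∃ C : ℝ, ∀ f ∈ sonineL a, ‖burnolEval f w k‖ ≤ C * ‖f‖ := by
  have hΓw : Gammaℝ w ≠ 0 := Gammaℝ_ne_zero_of_ne hw0 hwn
  -- an open neighbourhood of `w` avoiding `1` and the poles of `Γ_ℝ`, and a closed disc inside it
  set O : Set ℂ := {z | z ≠ 1 ∧ Gammaℝ z ≠ 0} with hO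
  have hOopen : IsOpen O := by
    have e : O = {z : ℂ | z ≠ 1} ∩ {z | (Gammaℝ z)⁻¹ ≠ 0} := by
      ext z; simp [hO, inv_eq_zero]
    rw [e]
    exact isOpen_ne.inter (isOpen_ne_fun differentiable_Gammaℝ_inv.continuous continuous_const)
  obtain ⟨R, hR0, hRO⟩ := Metric.isOpen_iff.1 hOopen w ⟨hw1, hΓw⟩
  set r : ℝ := R / 2 with hr
  have hr0 : 0 < r := by positivity
  have hsub : Metric.closedBall w r ⊆ O := (Metric.closedBall_subset_ball (by linarith)).trans hRO
  have hcpt : IsCompact (Metric.closedBall w r) := isCompact_closedBall w r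
  -- `f`-independent sup bounds on the closed disc
  obtain ⟨MΓ, hMΓ⟩ : ∃ M : ℝ, ∀ z ∈ Metric.closedBall w r, ‖Gammaℝ z‖ ≤ M :=
    hcpt.exists_bound_of_continuousOn fun z hz ↦
      (differentiableAt_Gammaℝ (hsub hz).2).continuousAt.continuousWithinAt
  have hMΓ0 : 0 ≤ MΓ := (norm_nonneg _).trans (hMΓ w (Metric.mem_closedBall_self hr0.le))
  obtain ⟨B₁, hB₁⟩ : ∃ B : ℝ, ∀ z ∈ Metric.closedBall w r, ‖(a : ℂ) ^ (1 - z) / (1 - z)‖ ≤ B := by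
    refine hcpt.exists_bound_of_continuousOn (ContinuousOn.div ?_ ?_ ?_)
    · exact ((differentiable_id.const_sub (1 : ℂ)).const_cpow
        (Or.inl (ofReal_ne_zero.2 ha.ne'))).continuous.continuousOn
    · exact (continuous_const.sub continuous_id).continuousOn
    · intro z hz; exact sub_ne_zero.2 (Ne.symm (hsub hz).1)
  have hl : (2 * π * a : ℝ) ≠ 0 := by positivity
  have h0 : Differentiable ℂ (fun s : ℂ ↦ 1 - s - 2) := (differentiable_id.const_sub (1 : ℂ)).sub_const 2
  have hE : Differentiable ℂ (fun z : ℂ ↦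
      (ibpEntire (2 * π * a) a (1 - z - 2) - ibpEntire (-(2 * π * a)) a (1 - z - 2)) / (2 * π * I)) :=
    (((differentiable_ibpEntire hl ha).comp h0).sub
      ((differentiable_ibpEntire (neg_ne_zero.2 hl) ha).comp h0)).div_const _
  obtain ⟨B₂, hB₂⟩ : ∃ B : ℝ, ∀ z ∈ Metric.closedBall w r,
      ‖(ibpEntire (2 * π * a) a (1 - z - 2) - ibpEntire (-(2 * π * a)) a (1 - z - 2)) / (2 * π * I)‖ ≤ B :=
    hcpt.exists_bound_of_continuousOn hE.continuous.continuousOn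
  obtain ⟨CS, hCS0, hCS⟩ := exists_bound_sonineMellinExt ha ha (1 + ‖w‖ + r)
  have hsq : 0 < Real.sqrt (2 * a) := Real.sqrt_pos.2 (by positivity)
  refine ⟨(k.factorial : ℝ) * (MΓ * ((B₁ / Real.sqrt (2 * a) + B₂ / Real.sqrt (2 * a) + CS))) / (r / 2) ^ k,
    fun f hf ↦ ?_⟩
  obtain ⟨heven, ⟨c, hc⟩, ⟨c', hc'⟩⟩ := hf
  have hfc := ae_const_Ioo_of_even heven hc
  have hFc := ae_const_Ioo_of_even (fourierL2_even heven) hc'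
  set G : ℂ → ℂ := fun s ↦ c * (a : ℂ) ^ (1 - s) / (1 - s) +
    c' * ((ibpEntire (2 * π * a) a (1 - s - 2) - ibpEntire (-(2 * π * a)) a (1 - s - 2)) /
      (2 * π * I)) +
    sonineMellinExt a a ((𝓕 f : Lp ℂ 2 (volume : Measure ℝ)) : ℝ → ℂ) (1 - s) with hG
  -- near `w`, `M(f) = Γ_ℝ · G`
  have heq : completedMellin (f : ℝ → ℂ) =ᶠ[𝓝 w] fun z ↦ Gammaℝ z * G z := by
    filter_upwards [isOpen_ne.mem_nhds hw1] with z hz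
    unfold completedMellin
    rw [rightMellinExt_eqOn_explicit ha f heven hfc hFc hG hz]
  have hk : burnolEval f w k = iteratedDeriv k (fun z ↦ Gammaℝ z * G z) w := by
    unfold burnolEval
    exact heq.iteratedDeriv_eq k
  -- the uniform bound on the disc
  have hc1 : ‖c‖ ≤ ‖f‖ / Real.sqrt (2 * a) := by
    rw [le_div_iff₀ hsq]; exact norm_const_mul_sqrt_le ha hfc
  have hc2 : ‖c'‖ ≤ ‖f‖ / Real.sqrt (2 * a) := by
    rw [le_div_iff₀ hsq, ← MeasureTheory.Lp.norm_fourier_eq f]; exact norm_const_mul_sqrt_le ha hFc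
  have hGz : ∀ z ∈ Metric.closedBall w r,
      ‖G z‖ ≤ (B₁ / Real.sqrt (2 * a) + B₂ / Real.sqrt (2 * a) + CS) * ‖f‖ := by
    intro z hz
    have hzw : ‖z - w‖ ≤ r := by rwa [Metric.mem_closedBall, dist_eq_norm] at hz
    have hz_le : ‖z‖ ≤ ‖w‖ + r :=
      calc ‖z‖ = ‖w + (z - w)‖ := by congr 1; ring
        _ ≤ ‖w‖ + ‖z - w‖ := norm_add_le _ _
        _ ≤ ‖w‖ + r := by linarith
    have h1z : ‖1 - z‖ ≤ 1 + ‖w‖ + r :=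
      calc ‖1 - z‖ ≤ ‖(1 : ℂ)‖ + ‖z‖ := norm_sub_le _ _
        _ ≤ 1 + ‖w‖ + r := by rw [norm_one]; linarith
    have hS : ‖sonineMellinExt a a ((𝓕 f : Lp ℂ 2 (volume : Measure ℝ)) : ℝ → ℂ) (1 - z)‖ ≤
        CS * ‖f‖ := by
      rw [← MeasureTheory.Lp.norm_fourier_eq f]; exact hCS _ _ h1z
    rw [hG]
    dsimp only
    calc ‖c * (a : ℂ) ^ (1 - z) / (1 - z) +
          c' * ((ibpEntire (2 * π * a) a (1 - z - 2) - ibpEntire (-(2 * π * a)) a (1 - z - 2)) /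
            (2 * π * I)) +
          sonineMellinExt a a ((𝓕 f : Lp ℂ 2 (volume : Measure ℝ)) : ℝ → ℂ) (1 - z)‖
        ≤ ‖c * (a : ℂ) ^ (1 - z) / (1 - z)‖ +
          ‖c' * ((ibpEntire (2 * π * a) a (1 - z - 2) - ibpEntire (-(2 * π * a)) a (1 - z - 2)) /
            (2 * π * I))‖ +
          ‖sonineMellinExt a a ((𝓕 f : Lp ℂ 2 (volume : Measure ℝ)) : ℝ → ℂ) (1 - z)‖ :=
          norm_add₃_le
      _ = ‖c‖ * ‖(a : ℂ) ^ (1 - z) / (1 - z)‖ +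
          ‖c'‖ * ‖(ibpEntire (2 * π * a) a (1 - z - 2) - ibpEntire (-(2 * π * a)) a (1 - z - 2)) /
            (2 * π * I)‖ +
          ‖sonineMellinExt a a ((𝓕 f : Lp ℂ 2 (volume : Measure ℝ)) : ℝ → ℂ) (1 - z)‖ := by
          rw [mul_div_assoc, norm_mul, norm_mul]
      _ ≤ ‖f‖ / Real.sqrt (2 * a) * B₁ + ‖f‖ / Real.sqrt (2 * a) * B₂ + CS * ‖f‖ := by
          have hb1 := hB₁ z hz
          have hb2 := hB₂ z hz
          gcongr
      _ = (B₁ / Real.sqrt (2 * a) + B₂ / Real.sqrt (2 * a) + CS) * ‖f‖ := by ring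
  have hM : ∀ z ∈ Metric.ball w r,
      ‖Gammaℝ z * G z‖ ≤ MΓ * ((B₁ / Real.sqrt (2 * a) + B₂ / Real.sqrt (2 * a) + CS) * ‖f‖) := by
    intro z hz
    have hz' := Metric.ball_subset_closedBall hz
    rw [norm_mul]
    exact mul_le_mul (hMΓ z hz') (hGz z hz') (norm_nonneg _) hMΓ0
  have hdiff : DifferentiableOn ℂ (fun z ↦ Gammaℝ z * G z) (Metric.ball w r) := by
    intro z hz
    have hzO := hsub (Metric.ball_subset_closedBall hz)
    exact ((differentiableAt_Gammaℝ hzO.2).mul ((differentiableOn_explicit ha f hG).differentiableAt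
      (isOpen_ne.mem_nhds hzO.1))).differentiableWithinAt
  rw [hk]
  calc ‖iteratedDeriv k (fun z ↦ Gammaℝ z * G z) w‖
      ≤ (k.factorial : ℝ) * (MΓ * ((B₁ / Real.sqrt (2 * a) + B₂ / Real.sqrt (2 * a) + CS) * ‖f‖)) / (r / 2) ^ k :=
        Literature.Analysis.Complex.norm_iteratedDeriv_le_of_forall_mem_ball hr0 hdiff hM k
    _ = (k.factorial : ℝ) * (MΓ * (B₁ / Real.sqrt (2 * a) + B₂ / Real.sqrt (2 * a) + CS)) / (r / 2) ^ k * ‖f‖ := by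
        ring

end SonineLContinuation

/-! ### Main statements: Prop. 2.2 (i) — the continuation of `f̂` for `f ∈ L_a` — and the discharge -/

open SonineLContinuation Literature.Analysis.DeBrangesSpaces.SonineMellin in
/-- **Prop. 2.2 (i) (Burnol 2004b = [Burnol2004, Thm. 6.10]) — the continuation of the right Mellin
transform on `L_a`.** For `f ∈ L_a` (`a > 0`), `f̂(s) = ∫_0^∞ f(t)t^{−s}dt` (absolutely convergent on
`1/2 < Re s < 1`) has a holomorphic continuation `G` to `ℂ ∖ {1}` with at most a simple pole at `s = 1`
(`(s−1)G(s)` has a limit at `1`) and trivial zeros at `s = −2n`, `n ≥ 1` — "an analytic function in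
`ℂ ∖ {1}` with at most a pole of order 1 at `s = 1`. It has trivial zeros at `s = −2n`, `n ≥ 1`"; EXACTLY
the first conjunct of the named fact `Burnol2004b_prop2_2`. The continuation is explicit:
`G(s) = c·a^{1−s}/(1−s) + c'·(J(2πa,a,−1−s) − J(−2πa,a,−1−s))/(2πi) + ∫_a^∞ 𝓕f(u)C_a(u,1−s)du`
(`c`, `c'` the constant values of `f`, `𝓕₊f` on `(0,a)`; `C_a`, `J` the entire kernels of
`BurnolCosineKernelEntire.lean`). [cite: Burnol2004b, Prop. 2.2 (arXiv:math/0203120v7 p. 5, TeX l.460–469); Burnol2004, Thm. 6.10 and its proof (TeX l.2417–2468)] -/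
theorem exists_hasRightMellinContinuation_of_mem_sonineL {a : ℝ} (ha : 0 < a)
    {f : Lp ℂ 2 (volume : Measure ℝ)} (hf : f ∈ sonineL a) :
    ∃ G : ℂ → ℂ, HasRightMellinContinuation f G ∧
      (∃ c : ℂ, Tendsto (fun s ↦ (s - 1) * G s) (𝓝[≠] (1 : ℂ)) (𝓝 c)) ∧
      ∀ n : ℕ, G (-2 * ((n : ℂ) + 1)) = 0 := by
  obtain ⟨heven, ⟨c, hc⟩, ⟨c', hc'⟩⟩ := hf
  have hfc := ae_const_Ioo_of_even heven hc
  have hFc := ae_const_Ioo_of_even (fourierL2_even heven) hc'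
  set G : ℂ → ℂ := fun s ↦ c * (a : ℂ) ^ (1 - s) / (1 - s) +
    c' * ((ibpEntire (2 * π * a) a (1 - s - 2) - ibpEntire (-(2 * π * a)) a (1 - s - 2)) /
      (2 * π * I)) +
    sonineMellinExt a a ((𝓕 f : Lp ℂ 2 (volume : Measure ℝ)) : ℝ → ℂ) (1 - s) with hG
  exact ⟨G, explicit_hasRightMellinContinuation ha f heven hfc hFc hG,
    ⟨-c, explicit_tendsto_sub_one_mul (c' := c') ha f hG⟩, explicit_trivial_zero ha f heven hfc hFc hG⟩

/-- **Prop. 2.2 (i) in the typed form**: the first conjunct of `Burnol2004b_prop2_2`, verbatim.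
[cite: Burnol2004b, Prop. 2.2 (arXiv:math/0203120v7 p. 5, TeX l.460–469)] -/
theorem Burnol2004b_prop2_2_i :
    ∀ a : ℝ, 0 < a →
      ∀ f ∈ sonineL a, ∃ G : ℂ → ℂ, HasRightMellinContinuation f G ∧
        (∃ c : ℂ, Tendsto (fun s ↦ (s - 1) * G s) (𝓝[≠] (1 : ℂ)) (𝓝 c)) ∧
        ∀ n : ℕ, G (-2 * ((n : ℂ) + 1)) = 0 :=
  fun _ ha _ hf ↦ exists_hasRightMellinContinuation_of_mem_sonineL ha hf

/-- **The canonical continuation `G_f = rightMellinExt f` of `f̂`, `f ∈ L_a`, HAS its defining property**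
(holomorphic off `s = 1`, equal to `f̂` on the strip): the `ε`-chosen object of `BurnolZetaSystems.lean`
is no longer junk on `L_a`. [cite: Burnol2004b, Prop. 2.2 and §4 Note (arXiv:math/0203120v7 pp. 5, 7; TeX l.460–469, 614–623)] -/
theorem hasRightMellinContinuation_rightMellinExt_of_mem_sonineL {a : ℝ} (ha : 0 < a)
    {f : Lp ℂ 2 (volume : Measure ℝ)} (hf : f ∈ sonineL a) :
    HasRightMellinContinuation f (rightMellinExt f) := by
  obtain ⟨G, hG, -, -⟩ := exists_hasRightMellinContinuation_of_mem_sonineL ha hf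
  exact hasRightMellinContinuation_rightMellinExt ⟨G, hG⟩

/-- For `f ∈ L_a` the canonical continuation has at most a simple pole at `1` and the trivial zeros
`−2(n+1)` (transport of the two remaining clauses along the uniqueness of the continuation).
[cite: Burnol2004b, Prop. 2.2 (arXiv:math/0203120v7 p. 5, TeX l.460–469)] -/
theorem rightMellinExt_pole_and_zeros_of_mem_sonineL {a : ℝ} (ha : 0 < a)
    {f : Lp ℂ 2 (volume : Measure ℝ)} (hf : f ∈ sonineL a) :
    (∃ c : ℂ, Tendsto (fun s ↦ (s - 1) * rightMellinExt f s) (𝓝[≠] (1 : ℂ)) (𝓝 c)) ∧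
      ∀ n : ℕ, rightMellinExt f (-2 * ((n : ℂ) + 1)) = 0 := by
  obtain ⟨G, hG, ⟨c, hc⟩, hz⟩ := exists_hasRightMellinContinuation_of_mem_sonineL ha hf
  have heq : Set.EqOn (rightMellinExt f) G {s | s ≠ 1} :=
    (hasRightMellinContinuation_rightMellinExt ⟨G, hG⟩).eqOn hG
  refine ⟨⟨c, hc.congr' ?_⟩, fun n ↦ ?_⟩
  · filter_upwards [self_mem_nhdsWithin] with s hs
    rw [heq hs]
  · rw [heq]
    · exact hz n
    · show (-2 * ((n : ℂ) + 1)) ≠ 1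
      intro h
      have := congrArg Complex.re h
      simp at this
      linarith

/-- **Discharge of the named fact `Burnol2004b_prop2_2`** (Burnol, JTNB 16 (2004), Prop. 2.2 = the
`L_a`-version of de Branges' theorem, Burnol Forum Math. Thm. 6.10): all five typed clauses — (i) the
continuation with at most a simple pole at `1` and the trivial zeros `−2, −4, …`; (ii) boundedness of the
evaluations `f ↦ M(f)^{(k)}(w)`; (iii) of the residue at `1`; (iv) of the value `f̂(0)`; (v) the functional
equation `M(𝓕₊f)(s) = M(f)(1−s)` — proved from the explicit continuation
`G_f(s) = c·a^{1−s}/(1−s) + c'·Ẽ_a(1−s) + ∫_a^∞ 𝓕f·C_a(·,1−s)` (sections B–P above).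
[cite: Burnol2004b, Prop. 2.2 (arXiv:math/0203120v7 p. 5, TeX l.460–476); Burnol2004, Thm. 6.10 (TeX l.2417–2462); Burnol2001CRAS, Lemme 1.2] -/
theorem Burnol2004b_prop2_2_holds : Burnol2004b_prop2_2 := fun _ ha ↦
  ⟨fun _ hf ↦ exists_hasRightMellinContinuation_of_mem_sonineL ha hf,
    fun _ hw0 hw1 hwn k ↦ SonineLContinuation.exists_bound_burnolEval_of_sonineL ha hw0 hw1 hwn k,
    SonineLContinuation.exists_bound_residueAt_rightMellinExt_one_of_sonineL ha,
    SonineLContinuation.exists_bound_rightMellinExt_zero_of_sonineL ha,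
    fun _ hf s hs0 hs1 ↦
      SonineLContinuation.rightMellinExt_functionalEquation_of_mem_sonineL ha hf s hs0 hs1⟩

end Literature.NumberTheory.LFunctions
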